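import Literature.Analysis.Distribution.LaplaceExpSumsCalculus
import Literature.Analysis.Distribution.ExpCutoffCalculus
import Literature.MathematicalPhysics.QuantumLattice.SchwartzFourierDensity
import Mathlib.Analysis.Calculus.BumpFunction.InnerProduct
import Mathlib.Analysis.SpecialFunctions.SmoothTransition
import Mathlib.Analysis.SpecialFunctions.Log.Deriv
import HarnessLib

/-!
# Exponential sums are dense in the Schwartz functions on a closed orthant

Topic `Literature/Analysis/Distribution`; second file (after `LaplaceExpSumsCalculus`) of the
several-variable form of Osterwalder–Schrader I (1973), Lemma 8.2 (with the Remark after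
Lemma 8.4): Laplace transforms `g ↦ ĝ(q) = ∫ e^{-qx} g(x) dx` of test functions supported in
`(0, ∞)` are dense in `𝒮(ℝ̄₊)`. The density is used by OS in §4.3, Lemma 4.1, to pass from the
Euclidean vectors of the OS Hilbert space to the Wightman vectors (positivity (R2), (4.28), and
the cluster property (R4), (4.30)).

Here: on `V = ℝ^m × ℝ^{ι₂}` (`m` Laplace variables `σ`, Fourier/parameter variables `q`), every
compactly supported Schwartz function `φ` is approximated **on the closed orthant `{σᵢ ≥ 0}`,
uniformly with all derivatives up to a prescribed order and all polynomial weights**, by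
*exponential sums* `∑_r c_r e^{-⟨a_r, σ⟩} ψ_r(q)` with rates `a_r ∈ [1, ∞)^m` and smooth compactly
supported `ψ_r` (`expSumSpan`; `exists_expSum_approx`). These are exactly the Laplace–Fourier
transforms of finite combinations of `δ_{a_r} ⊗ ψ̌_r`, smeared into honest test functions in the
third file `LaplaceFourierDensity`.

## Proof

Substitute `uᵢ = e^{-σᵢ}` (`expNegMap`): the orthant becomes the cube `(0, 1]^m`, exponential
sums with integer rates become polynomials in `u` vanishing on the faces `{uᵢ = 0}`, and
`φ(σ, q) = H(e^{-σ}, q)` with `H(u, q) = (∏ᵢ uᵢ) Ψ(u, q)`, `Ψ(u, q) = φ(-log u, q) ∏ᵢ κ(uᵢ)/uᵢ` a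
compactly supported Schwartz function on `V` (`κ` a smooth step vanishing near `0` and equal to `1`
from `e^{-R-1}` on, `R` the support radius of `φ`; `pullback`). The tree's Fourier-series engine
`Literature.MathematicalPhysics.QuantumLattice.tendsto_sum_boxCoeff_smul` (`SchwartzFourierDensity`),
run in affine box coordinates which are block-diagonal in `(u, q)`, expands `Ψ` in the Schwartz
topology into finite sums of products `[cut-off character in u] · [cut-off character in q]`; on
`[0, 1]^m` the `u`-cutoff is `1` and the `u`-character `e^{i⟨β, u⟩}` is replaced by its Taylor
polynomial (`expTrunc`, with the uniform tail estimate of `LaplaceExpSumsCalculus`). Multiplying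
back by `∏ᵢ uᵢ` and composing with `expNegMap` gives an element of `expSumSpan` (`truncSum_mem`).
The error `φ − G = (H − E) ∘ expNegMap` is estimated with Mathlib's Faà di Bruno bound
`norm_iteratedFDeriv_comp_le` (jets of `H − E` are small at the image points; derivatives of
`expNegMap` are bounded); on the part of the orthant where a coordinate `σᵢ` is large both `φ`
and `Ψ` vanish and the factor `uᵢ = e^{-σᵢ}` of `E` absorbs the polynomial weight.

## References

* K. Osterwalder, R. Schrader, *Axioms for Euclidean Green's functions*, Comm. Math. Phys. 31
  (1973) 83–112, §8 Lemma 8.2 and Remark after Lemma 8.4; §4.3 Lemma 4.1.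
  [OsterwalderSchraderCMP1973]
-/

noncomputable section

open Filter Topology Set Complex MeasureTheory
open scoped ContDiff SchwartzMap FourierTransform
open Literature.MathematicalPhysics.QuantumLattice

namespace Literature.Analysis.Distribution

variable {m : ℕ} {ι₂ : Type*} [Fintype ι₂]

variable (m ι₂) in
/-- The space `ℝ^m × ℝ^{ι₂}` of `m` Laplace variables and finitely many Fourier variables. [folklore] -/
abbrev OrthSpace : Type _ := (Fin m → ℝ) × EuclideanSpace ℝ ι₂

variable (m ι₂) in
/-- The closed orthant `{(σ, q) | σᵢ ≥ 0 ∀ i}`. [folklore] -/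
def orthant : Set (OrthSpace m ι₂) := {x | ∀ i, 0 ≤ x.1 i}

/-! ### Exponential sums -/

/-- The generator `(σ, q) ↦ e^{-⟨a, σ⟩} ψ(q)`. [folklore] -/
def expGen (a : Fin m → ℝ) (ψ : EuclideanSpace ℝ ι₂ → ℂ) : OrthSpace m ι₂ → ℂ :=
  fun x => ((Real.exp (-(∑ i, a i * x.1 i)) : ℝ) : ℂ) * ψ x.2

omit [Fintype ι₂] in
/-- Unfolding `expGen`. [folklore] -/
theorem expGen_apply (a : Fin m → ℝ) (ψ : EuclideanSpace ℝ ι₂ → ℂ) (x : OrthSpace m ι₂) :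
    expGen a ψ x = ((Real.exp (-(∑ i, a i * x.1 i)) : ℝ) : ℂ) * ψ x.2 := rfl

variable (m ι₂) in
/-- The generating set: `e^{-⟨a, σ⟩} ψ(q)` with all rates `aᵢ ≥ 1` and `ψ` smooth of compact
support. [folklore] -/
def expSumSet : Set (OrthSpace m ι₂ → ℂ) :=
  {G | ∃ (a : Fin m → ℝ) (ψ : EuclideanSpace ℝ ι₂ → ℂ),
    (∀ i, 1 ≤ a i) ∧ ContDiff ℝ ∞ ψ ∧ HasCompactSupport ψ ∧ G = expGen a ψ}

variable (m ι₂) in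
/-- **Exponential sums**: the `ℂ`-span of the generators `e^{-⟨a, σ⟩} ψ(q)`, `a ∈ [1, ∞)^m`,
`ψ ∈ C_c^∞` (the Laplace–Fourier transforms of the measures `δ_a ⊗ ψ̌`; OS I (1973), proof of
Lemma 8.2, the functions `e^{-qx}`). [cite: OsterwalderSchraderCMP1973, §8 Lemma 8.2] -/
def expSumSpan : Submodule ℂ (OrthSpace m ι₂ → ℂ) := Submodule.span ℂ (expSumSet m ι₂)

/-- Generators belong to the span. [folklore] -/
theorem expGen_mem {a : Fin m → ℝ} (ha : ∀ i, 1 ≤ a i) {ψ : EuclideanSpace ℝ ι₂ → ℂ}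
    (hψ : ContDiff ℝ ∞ ψ) (hψc : HasCompactSupport ψ) : expGen a ψ ∈ expSumSpan m ι₂ :=
  Submodule.subset_span ⟨a, ψ, ha, hψ, hψc, rfl⟩

/-- Generators are smooth. [folklore] -/
theorem contDiff_expGen (a : Fin m → ℝ) {ψ : EuclideanSpace ℝ ι₂ → ℂ} (hψ : ContDiff ℝ ∞ ψ) :
    ContDiff ℝ ∞ (expGen a ψ) := by
  unfold expGen
  refine ContDiff.mul ?_ (hψ.comp contDiff_snd)
  refine Complex.ofRealCLM.contDiff.comp (Real.contDiff_exp.comp ?_)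
  exact (ContDiff.sum fun i _ => contDiff_const.mul ((contDiff_apply ℝ ℝ i).comp contDiff_fst)).neg

/-- Exponential sums are smooth. [folklore] -/
theorem contDiff_of_mem_expSumSpan {G : OrthSpace m ι₂ → ℂ} (hG : G ∈ expSumSpan m ι₂) :
    ContDiff ℝ ∞ G := by
  induction hG using Submodule.span_induction with
  | mem G hG =>
    obtain ⟨a, ψ, -, hψ, -, rfl⟩ := hG
    exact contDiff_expGen a hψ
  | zero => exact contDiff_const
  | add G G' _ _ hG hG' => exact hG.add hG'
  | smul c G _ hG => exact contDiff_const.smul hG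

omit [Fintype ι₂] in
/-- Multiplying a generator by `e^{-σᵢ}` raises the `i`-th rate by one. [folklore] -/
theorem expNeg_mul_expGen (i : Fin m) (a : Fin m → ℝ) (ψ : EuclideanSpace ℝ ι₂ → ℂ) :
    (fun x : OrthSpace m ι₂ => ((Real.exp (-(x.1 i)) : ℝ) : ℂ) * expGen a ψ x) =
      expGen (a + Pi.single i 1) ψ := by
  funext x
  rw [expGen_apply, expGen_apply, ← mul_assoc, ← Complex.ofReal_mul, ← Real.exp_add]
  congr 3
  have hs : ∑ j, (a + Pi.single i 1 : Fin m → ℝ) j * x.1 j = ∑ j, a j * x.1 j + x.1 i := by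
    simp only [Pi.add_apply, add_mul, Finset.sum_add_distrib]
    congr 1
    rw [Finset.sum_eq_single i (fun j _ hj => by rw [Pi.single_eq_of_ne hj, zero_mul])
      (fun h => absurd (Finset.mem_univ i) h)]
    simp
  rw [hs]
  ring

/-- **The span is stable under multiplication by `e^{-σᵢ}`.** [folklore] -/
theorem expNeg_mul_mem (i : Fin m) {G : OrthSpace m ι₂ → ℂ} (hG : G ∈ expSumSpan m ι₂) :
    (fun x : OrthSpace m ι₂ => ((Real.exp (-(x.1 i)) : ℝ) : ℂ) * G x) ∈ expSumSpan m ι₂ := by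
  induction hG using Submodule.span_induction with
  | mem G hG =>
    obtain ⟨a, ψ, ha, hψ, hψc, rfl⟩ := hG
    rw [expNeg_mul_expGen]
    refine expGen_mem (fun j => ?_) hψ hψc
    by_cases hj : j = i
    · subst hj; simp only [Pi.add_apply, Pi.single_eq_same]; linarith [ha j]
    · simp only [Pi.add_apply, Pi.single_eq_of_ne hj, add_zero]; exact ha j
  | zero =>
    have : (fun x : OrthSpace m ι₂ => ((Real.exp (-(x.1 i)) : ℝ) : ℂ) * (0 : OrthSpace m ι₂ → ℂ) x) = 0 := by
      funext x; simp
    rw [this]; exact Submodule.zero_mem _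
  | add G G' _ _ hG hG' =>
    have : (fun x : OrthSpace m ι₂ => ((Real.exp (-(x.1 i)) : ℝ) : ℂ) * (G + G') x) =
        (fun x => ((Real.exp (-(x.1 i)) : ℝ) : ℂ) * G x) + fun x => ((Real.exp (-(x.1 i)) : ℝ) : ℂ) * G' x := by
      funext x; simp [mul_add]
    rw [this]; exact Submodule.add_mem _ hG hG'
  | smul c G _ hG =>
    have : (fun x : OrthSpace m ι₂ => ((Real.exp (-(x.1 i)) : ℝ) : ℂ) * (c • G) x) =
        c • fun x => ((Real.exp (-(x.1 i)) : ℝ) : ℂ) * G x := by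
      funext x; simp [mul_left_comm]
    rw [this]; exact Submodule.smul_mem _ c hG

/-- The span is stable under multiplication by `∑ᵢ bᵢ e^{-σᵢ}`. [folklore] -/
theorem linExp_mul_mem (b : Fin m → ℝ) {G : OrthSpace m ι₂ → ℂ} (hG : G ∈ expSumSpan m ι₂) :
    (fun x : OrthSpace m ι₂ => ((∑ i, b i * Real.exp (-(x.1 i)) : ℝ) : ℂ) * G x) ∈ expSumSpan m ι₂ := by
  have h : (fun x : OrthSpace m ι₂ => ((∑ i, b i * Real.exp (-(x.1 i)) : ℝ) : ℂ) * G x) =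
      ∑ i, (b i : ℂ) • fun x : OrthSpace m ι₂ => ((Real.exp (-(x.1 i)) : ℝ) : ℂ) * G x := by
    funext x
    simp only [Finset.sum_apply, Pi.smul_apply, smul_eq_mul]
    push_cast
    rw [Finset.sum_mul]
    refine Finset.sum_congr rfl fun i _ => ?_
    ring
  rw [h]
  exact Submodule.sum_mem _ fun i _ => Submodule.smul_mem _ _ (expNeg_mul_mem i hG)

/-- The span is stable under multiplication by powers of `∑ᵢ bᵢ e^{-σᵢ}`. [folklore] -/
theorem linExp_pow_mul_mem (b : Fin m → ℝ) (l : ℕ) {G : OrthSpace m ι₂ → ℂ}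
    (hG : G ∈ expSumSpan m ι₂) :
    (fun x : OrthSpace m ι₂ => ((∑ i, b i * Real.exp (-(x.1 i)) : ℝ) : ℂ) ^ l * G x) ∈ expSumSpan m ι₂ := by
  induction l with
  | zero => simpa using hG
  | succ l ih =>
    have h := linExp_mul_mem b ih
    have : (fun x : OrthSpace m ι₂ => ((∑ i, b i * Real.exp (-(x.1 i)) : ℝ) : ℂ) ^ (l + 1) * G x) =
        fun x => ((∑ i, b i * Real.exp (-(x.1 i)) : ℝ) : ℂ) *
          (((∑ i, b i * Real.exp (-(x.1 i)) : ℝ) : ℂ) ^ l * G x) := by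
      funext x; ring
    rw [this]; exact h

/-- The basic element `(∏ᵢ e^{-σᵢ}) ψ(q) = e^{-⟨1, σ⟩} ψ(q)` of the span. [folklore] -/
theorem prodExp_mul_mem {ψ : EuclideanSpace ℝ ι₂ → ℂ} (hψ : ContDiff ℝ ∞ ψ) (hψc : HasCompactSupport ψ) :
    (fun x : OrthSpace m ι₂ => ((∏ i, Real.exp (-(x.1 i)) : ℝ) : ℂ) * ψ x.2) ∈ expSumSpan m ι₂ := by
  have h : (fun x : OrthSpace m ι₂ => ((∏ i, Real.exp (-(x.1 i)) : ℝ) : ℂ) * ψ x.2) = expGen (fun _ => 1) ψ := by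
    funext x
    rw [expGen_apply, ← Real.exp_sum]
    simp
  rw [h]
  exact expGen_mem (fun _ => le_rfl) hψ hψc

/-! ### The smooth step `κ` and the pull-back `Ψ` of `φ` to the `u`-variables -/

section Pullback

variable (η : ℝ)

/-- The smooth step `κ_η`: `0` on `(-∞, η/2]`, `1` on `[η, ∞)` (Mathlib's `Real.smoothTransition`
rescaled). [folklore] -/
def stepFun (u : ℝ) : ℝ := Real.smoothTransition (2 * u / η - 1)

/-- `κ_η` is smooth. [folklore] -/
theorem contDiff_stepFun : ContDiff ℝ ∞ (stepFun η) :=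
  Real.smoothTransition.contDiff.comp ((contDiff_const.mul contDiff_id).div_const _ |>.sub contDiff_const)

variable {η}

/-- `κ_η = 1` on `[η, ∞)` (`η > 0`). [folklore] -/
theorem stepFun_of_le (hη : 0 < η) {u : ℝ} (hu : η ≤ u) : stepFun η u = 1 := by
  unfold stepFun
  refine Real.smoothTransition.one_of_one_le ?_
  rw [le_sub_iff_add_le, le_div_iff₀ hη]
  linarith

/-- `κ_η = 0` on `(-∞, η/2]` (`η > 0`). [folklore] -/
theorem stepFun_of_le_half (hη : 0 < η) {u : ℝ} (hu : u ≤ η / 2) : stepFun η u = 0 := by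
  unfold stepFun
  refine Real.smoothTransition.zero_of_nonpos ?_
  rw [sub_nonpos, div_le_one hη]
  linarith

/-- `tsupport κ_η ⊆ [η/2, ∞)`. [folklore] -/
theorem tsupport_stepFun_subset (hη : 0 < η) : tsupport (stepFun η) ⊆ Ici (η / 2) := by
  refine closure_minimal (fun u hu => ?_) isClosed_Ici
  by_contra h
  exact hu (stepFun_of_le_half hη (le_of_not_ge h))

variable (η) in
/-- The smooth function `κ_η(u) / u` (extended by `0` near `u ≤ 0`, where `κ_η` vanishes),
complex-valued. [folklore] -/
def stepDiv (u : ℝ) : ℂ := ((u⁻¹ : ℝ) : ℂ) * (stepFun η u : ℂ)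

/-- `κ_η(u)/u` is smooth (`η > 0`). [folklore] -/
theorem contDiff_stepDiv (hη : 0 < η) : ContDiff ℝ ∞ (stepDiv η) := by
  unfold stepDiv
  refine ContDiff.mul_of_tsupport_subset (U := {u : ℝ | u ≠ 0}) isOpen_ne ?_ ?_ ?_
  · exact Complex.ofRealCLM.contDiff.comp_contDiffOn (contDiffOn_inv ℝ)
  · exact Complex.ofRealCLM.contDiff.comp (contDiff_stepFun η)
  · intro u hu h0
    have hu' : u ∈ tsupport (stepFun η) := by
      have hs : (Function.support fun u => (stepFun η u : ℂ)) = Function.support (stepFun η) := by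
        ext u; simp [Function.mem_support]
      simpa [tsupport, hs] using hu
    have h1 := tsupport_stepFun_subset hη hu'
    rw [mem_Ici, h0] at h1
    linarith

/-- `u · (κ_η(u)/u) = κ_η(u)` for `u ≠ 0`. [folklore] -/
theorem mul_stepDiv {u : ℝ} (hu : u ≠ 0) : (u : ℂ) * stepDiv η u = (stepFun η u : ℂ) := by
  unfold stepDiv
  rw [← mul_assoc, ← Complex.ofReal_mul, mul_inv_cancel₀ hu, Complex.ofReal_one, one_mul]

end Pullback

/-! ### The pull-back `Ψ` of a compactly supported `φ` -/

section PullbackDef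

/-- The rate `η_R = e^{-(R+1)}`: for `σᵢ ≤ R + 1` one has `uᵢ = e^{-σᵢ} ≥ η_R`. [folklore] -/
def etaOf (R : ℝ) : ℝ := Real.exp (-(R + 1))

/-- `η_R > 0`. [folklore] -/
theorem etaOf_pos (R : ℝ) : 0 < etaOf R := Real.exp_pos _

omit [Fintype ι₂] in
/-- The inverse change of variables `(u, q) ↦ ((-log uᵢ)ᵢ, q)` on `(0, ∞)^m × ℝ^{ι₂}`. [folklore] -/
def negLog (v : OrthSpace m ι₂) : OrthSpace m ι₂ := (fun i => -Real.log (v.1 i), v.2)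

omit [Fintype ι₂] in
/-- `negLog ∘ expNegMap = id`. [folklore] -/
@[simp] theorem negLog_expNegMap (x : OrthSpace m ι₂) :
    negLog (expNegMap m (EuclideanSpace ℝ ι₂) x) = x := by
  rcases x with ⟨σ, q⟩
  simp [negLog, expNegMap, Real.log_exp]

/-- **The pull-back** `Ψ(u, q) = φ(-log u, q) ∏ᵢ κ_{η_R}(uᵢ)/uᵢ` of `φ` to the `u`-variables
(`uᵢ = e^{-σᵢ}`), divided by `∏ uᵢ` and cut off smoothly near the faces `{uᵢ = 0}`. [folklore] -/
def pullback (φ : OrthSpace m ι₂ → ℂ) (R : ℝ) : OrthSpace m ι₂ → ℂ :=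
  fun v => φ (negLog v) * ∏ i, stepDiv (etaOf R) (v.1 i)

omit [Fintype ι₂] in
/-- Unfolding `pullback`. [folklore] -/
theorem pullback_apply (φ : OrthSpace m ι₂ → ℂ) (R : ℝ) (v : OrthSpace m ι₂) :
    pullback φ R v = φ (negLog v) * ∏ i, stepDiv (etaOf R) (v.1 i) := rfl

omit [Fintype ι₂] in
/-- The open set `{uᵢ > 0 ∀ i}`. [folklore] -/
theorem isOpen_posOrthant : IsOpen {v : OrthSpace m ι₂ | ∀ i, 0 < v.1 i} := by
  have : {v : OrthSpace m ι₂ | ∀ i, 0 < v.1 i} = ⋂ i, {v | 0 < v.1 i} := by ext v; simp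
  rw [this]
  exact isOpen_iInter_of_finite fun i =>
    isOpen_lt continuous_const ((continuous_apply i).comp continuous_fst)

/-- `negLog` is smooth on `{uᵢ > 0}`. [folklore] -/
theorem contDiffOn_negLog : ContDiffOn ℝ ∞ (negLog (m := m) (ι₂ := ι₂)) {v | ∀ i, 0 < v.1 i} := by
  refine ContDiffOn.prodMk ?_ contDiff_snd.contDiffOn
  refine contDiffOn_pi.2 fun i => ?_
  have h1 : ContDiff ℝ ∞ fun v : OrthSpace m ι₂ => v.1 i := (contDiff_apply ℝ ℝ i).comp contDiff_fst
  exact (Real.contDiffOn_log.comp h1.contDiffOn fun v hv => (hv i).ne').neg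

/-- The cut-off factor `∏ᵢ κ(uᵢ)/uᵢ` is smooth. [folklore] -/
theorem contDiff_prod_stepDiv {η : ℝ} (hη : 0 < η) :
    ContDiff ℝ ∞ fun v : OrthSpace m ι₂ => ∏ i, stepDiv η (v.1 i) :=
  contDiff_prod fun i _ => (contDiff_stepDiv hη).comp ((contDiff_apply ℝ ℝ i).comp contDiff_fst)

omit [Fintype ι₂] in
/-- The cut-off factor is supported in `{uᵢ ≥ η/2 ∀ i}`. [folklore] -/
theorem tsupport_prod_stepDiv_subset {η : ℝ} (hη : 0 < η) :
    tsupport (fun v : OrthSpace m ι₂ => ∏ i, stepDiv η (v.1 i)) ⊆ {v | ∀ i, η / 2 ≤ v.1 i} := by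
  have hcl : IsClosed {v : OrthSpace m ι₂ | ∀ i, η / 2 ≤ v.1 i} := by
    have : {v : OrthSpace m ι₂ | ∀ i, η / 2 ≤ v.1 i} = ⋂ i, {v | η / 2 ≤ v.1 i} := by ext v; simp
    rw [this]
    exact isClosed_iInter fun i => isClosed_le continuous_const ((continuous_apply i).comp continuous_fst)
  refine closure_minimal (fun v hv i => ?_) hcl
  by_contra h
  push Not at h
  have h0 : stepFun η (v.1 i) = 0 := stepFun_of_le_half hη h.le
  exact hv (Finset.prod_eq_zero (Finset.mem_univ i) (by simp [stepDiv, h0]))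

/-- `Ψ` is smooth when `φ` is. [folklore] -/
theorem contDiff_pullback {φ : OrthSpace m ι₂ → ℂ} (hφ : ContDiff ℝ ∞ φ) (R : ℝ) :
    ContDiff ℝ ∞ (pullback φ R) := by
  unfold pullback
  refine ContDiff.mul_of_tsupport_subset isOpen_posOrthant (hφ.comp_contDiffOn contDiffOn_negLog)
    (contDiff_prod_stepDiv (etaOf_pos R)) ?_
  exact (tsupport_prod_stepDiv_subset (etaOf_pos R)).trans fun v hv i =>
    lt_of_lt_of_le (half_pos (etaOf_pos R)) (hv i)

variable (R : ℝ) in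
/-- The compact box `[e^{-R}, e^{R}]^m × B̄(0, R)` carrying `Ψ`. [folklore] -/
def pullbackBox : Set (OrthSpace m ι₂) :=
  (Set.univ.pi fun _ : Fin m => Icc (Real.exp (-R)) (Real.exp R)) ×ˢ Metric.closedBall 0 R

/-- The box is compact. [folklore] -/
theorem isCompact_pullbackBox (R : ℝ) : IsCompact (pullbackBox (m := m) (ι₂ := ι₂) R) :=
  (isCompact_univ_pi fun _ => isCompact_Icc).prod (isCompact_closedBall 0 R)

/-- The box is closed. [folklore] -/
theorem isClosed_pullbackBox (R : ℝ) : IsClosed (pullbackBox (m := m) (ι₂ := ι₂) R) :=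
  (isCompact_pullbackBox R).isClosed

/-- **Support of `Ψ`**: if `supp φ ⊆ B̄(0, R)` then `Ψ` vanishes off `[e^{-R}, e^R]^m × B̄(0, R)`. [folklore] -/
theorem pullback_eq_zero_of_notMem {φ : OrthSpace m ι₂ → ℂ} {R : ℝ}
    (hφR : tsupport φ ⊆ Metric.closedBall 0 R) {v : OrthSpace m ι₂} (hv : v ∉ pullbackBox R) :
    pullback φ R v = 0 := by
  rw [pullback_apply]
  by_cases hstep : ∏ i, stepDiv (etaOf R) (v.1 i) = 0
  · rw [hstep, mul_zero]
  -- all `uᵢ > η/2 > 0`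
  have hpos : ∀ i, 0 < v.1 i := fun i => by
    by_contra h
    push Not at h
    have h0 : stepFun (etaOf R) (v.1 i) = 0 :=
      stepFun_of_le_half (etaOf_pos R) (h.trans (half_pos (etaOf_pos R)).le)
    exact hstep (Finset.prod_eq_zero (Finset.mem_univ i) (by simp [stepDiv, h0]))
  by_cases hφv : φ (negLog v) = 0
  · rw [hφv, zero_mul]
  exfalso
  have hmem : negLog v ∈ Metric.closedBall (0 : OrthSpace m ι₂) R := hφR (subset_tsupport _ hφv)
  rw [Metric.mem_closedBall, dist_zero_right] at hmem
  refine hv ⟨fun i _ => ?_, ?_⟩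
  · have hi : |Real.log (v.1 i)| ≤ R := by
      have h1 : ‖(negLog v).1‖ ≤ R := (norm_fst_le (negLog v)).trans hmem
      have h2 : ‖(negLog v).1 i‖ ≤ ‖(negLog v).1‖ := norm_le_pi_norm _ i
      have h3 : (negLog v).1 i = -Real.log (v.1 i) := rfl
      rw [h3, norm_neg, Real.norm_eq_abs] at h2
      linarith
    rw [abs_le] at hi
    constructor
    · calc Real.exp (-R) ≤ Real.exp (Real.log (v.1 i)) := Real.exp_le_exp.2 hi.1
        _ = v.1 i := Real.exp_log (hpos i)
    · calc v.1 i = Real.exp (Real.log (v.1 i)) := (Real.exp_log (hpos i)).symm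
        _ ≤ Real.exp R := Real.exp_le_exp.2 hi.2
  · rw [Metric.mem_closedBall, dist_zero_right]
    exact (norm_snd_le (negLog v)).trans hmem

/-- `tsupport Ψ ⊆ [e^{-R}, e^R]^m × B̄(0, R)`. [folklore] -/
theorem tsupport_pullback_subset {φ : OrthSpace m ι₂ → ℂ} {R : ℝ}
    (hφR : tsupport φ ⊆ Metric.closedBall 0 R) : tsupport (pullback φ R) ⊆ pullbackBox R :=
  closure_minimal (fun _ hv => by_contra fun h => hv (pullback_eq_zero_of_notMem hφR h))
    (isClosed_pullbackBox R)

/-- `Ψ` has compact support. [folklore] -/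
theorem hasCompactSupport_pullback {φ : OrthSpace m ι₂ → ℂ} {R : ℝ}
    (hφR : tsupport φ ⊆ Metric.closedBall 0 R) : HasCompactSupport (pullback φ R) :=
  HasCompactSupport.intro (isCompact_pullbackBox R) fun _ hv => pullback_eq_zero_of_notMem hφR hv

/-- **`φ = H ∘ expNegMap`** with `H(u, q) = (∏ᵢ uᵢ) Ψ(u, q)`: on `ℝ^m × ℝ^{ι₂}`,
`(∏ᵢ e^{-σᵢ}) Ψ(e^{-σ}, q) = φ(σ, q)` — where some `σᵢ > R + 1` both sides vanish, elsewhere all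
steps `κ(e^{-σᵢ})` equal `1`. [folklore] -/
theorem prodExp_mul_pullback_expNegMap {φ : OrthSpace m ι₂ → ℂ} {R : ℝ}
    (hφR : tsupport φ ⊆ Metric.closedBall 0 R) (x : OrthSpace m ι₂) :
    ((∏ i, Real.exp (-(x.1 i)) : ℝ) : ℂ) * pullback φ R (expNegMap m (EuclideanSpace ℝ ι₂) x) = φ x := by
  rw [pullback_apply, negLog_expNegMap]
  have hprod : ((∏ i, Real.exp (-(x.1 i)) : ℝ) : ℂ) *
      ∏ i, stepDiv (etaOf R) ((expNegMap m (EuclideanSpace ℝ ι₂) x).1 i) =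
      ∏ i, (stepFun (etaOf R) (Real.exp (-(x.1 i))) : ℂ) := by
    rw [Complex.ofReal_prod, ← Finset.prod_mul_distrib]
    refine Finset.prod_congr rfl fun i _ => ?_
    rw [expNegMap_fst]
    exact mul_stepDiv (Real.exp_pos _).ne'
  rw [mul_left_comm, hprod]
  by_cases hall : ∀ i, x.1 i ≤ R + 1
  · have h1 : ∀ i, (stepFun (etaOf R) (Real.exp (-(x.1 i))) : ℂ) = 1 := fun i => by
      rw [stepFun_of_le (etaOf_pos R) (Real.exp_le_exp.2 (by linarith [hall i]))]
      simp
    simp [h1]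
  · push Not at hall
    obtain ⟨i, hi⟩ := hall
    have hx : x ∉ tsupport φ := fun h => by
      have h1 := hφR h
      rw [Metric.mem_closedBall, dist_zero_right] at h1
      have h2 : |x.1 i| ≤ R :=
        ((Real.norm_eq_abs _).symm.le.trans (norm_le_pi_norm x.1 i)).trans ((norm_fst_le x).trans h1)
      have h3 := le_abs_self (x.1 i)
      linarith
    rw [image_eq_zero_of_notMem_tsupport hx, zero_mul]

/-- **`Ψ` vanishes near the faces**: if some `σᵢ ≥ R + 2` then `expNegMap (σ, q) ∉ tsupport Ψ`. [folklore] -/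
theorem expNegMap_notMem_tsupport_pullback {φ : OrthSpace m ι₂ → ℂ} {R : ℝ}
    (hφR : tsupport φ ⊆ Metric.closedBall 0 R) {x : OrthSpace m ι₂} {i : Fin m}
    (hi : R + 2 ≤ x.1 i) : expNegMap m (EuclideanSpace ℝ ι₂) x ∉ tsupport (pullback φ R) := by
  intro h
  have h1 := (tsupport_pullback_subset hφR h).1 i (Set.mem_univ _)
  rw [expNegMap_fst, mem_Icc] at h1
  have h2 : Real.exp (-(x.1 i)) < Real.exp (-R) := Real.exp_lt_exp.2 (by linarith)
  linarith [h1.1]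

end PullbackDef

/-! ### Block-diagonal box coordinates and the cut-offs of the Fourier engine -/

section Box

/-- The block-diagonal scaling `(u, q) ↦ (a u, b q)` as a linear equivalence onto `ℝ^{m ⊕ ι₂}`. [folklore] -/
def scaleEquiv (a b : ℝ) (ha : a ≠ 0) (hb : b ≠ 0) : OrthSpace m ι₂ ≃ₗ[ℝ] EuclideanSpace ℝ (Fin m ⊕ ι₂) where
  toFun v := WithLp.toLp 2 (Sum.elim (fun i => a * v.1 i) (fun j => b * v.2 j))
  invFun y := (fun i => a⁻¹ * y (Sum.inl i), WithLp.toLp 2 fun j => b⁻¹ * y (Sum.inr j))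
  map_add' v w := by
    ext c; rcases c with i | j <;> simp [mul_add]
  map_smul' r v := by
    ext c; rcases c with i | j <;> simp [mul_left_comm]
  left_inv v := by
    refine Prod.ext (funext fun i => ?_) ?_
    · simp [ha]
    · ext j; simp [hb]
  right_inv y := by
    ext c; rcases c with i | j
    · simp [ha]
    · simp [hb]

/-- The same as a continuous linear equivalence (finite dimension). [folklore] -/
def scaleCLE (a b : ℝ) (ha : a ≠ 0) (hb : b ≠ 0) : OrthSpace m ι₂ ≃L[ℝ] EuclideanSpace ℝ (Fin m ⊕ ι₂) :=
  (scaleEquiv a b ha hb).toContinuousLinearEquiv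

/-- `u`-coordinates of `scaleCLE`. [folklore] -/
@[simp] theorem scaleCLE_apply_inl {a b : ℝ} (ha : a ≠ 0) (hb : b ≠ 0) (v : OrthSpace m ι₂) (i : Fin m) :
    scaleCLE a b ha hb v (Sum.inl i) = a * v.1 i := rfl

/-- `q`-coordinates of `scaleCLE`. [folklore] -/
@[simp] theorem scaleCLE_apply_inr {a b : ℝ} (ha : a ≠ 0) (hb : b ≠ 0) (v : OrthSpace m ι₂) (j : ι₂) :
    scaleCLE a b ha hb v (Sum.inr j) = b * v.2 j := rfl

variable (m ι₂) in
/-- The shift `(2a, …, 2a, ½, …, ½)` of the box coordinates. [folklore] -/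
def boxShiftVec (a : ℝ) : EuclideanSpace ℝ (Fin m ⊕ ι₂) :=
  WithLp.toLp 2 (Sum.elim (fun _ : Fin m => 2 * a) (fun _ : ι₂ => (1 / 2 : ℝ)))

omit [Fintype ι₂] in
/-- `u`-coordinates of the shift. [folklore] -/
@[simp] theorem boxShiftVec_inl (a : ℝ) (i : Fin m) : boxShiftVec m ι₂ a (Sum.inl i) = 2 * a := rfl

omit [Fintype ι₂] in
/-- `q`-coordinates of the shift. [folklore] -/
@[simp] theorem boxShiftVec_inr (a : ℝ) (j : ι₂) : boxShiftVec m ι₂ a (Sum.inr j) = 1 / 2 := rfl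

/-- `u`-coordinates of the affine box map `v ↦ L v + w`. [folklore] -/
@[simp] theorem boxCoord_inl {a b : ℝ} (ha : a ≠ 0) (hb : b ≠ 0) (v : OrthSpace m ι₂) (i : Fin m) :
    (scaleCLE a b ha hb v + boxShiftVec m ι₂ a) (Sum.inl i) = a * v.1 i + 2 * a := by
  rw [PiLp.add_apply, scaleCLE_apply_inl, boxShiftVec_inl]

/-- `q`-coordinates of the affine box map. [folklore] -/
@[simp] theorem boxCoord_inr {a b : ℝ} (ha : a ≠ 0) (hb : b ≠ 0) (v : OrthSpace m ι₂) (j : ι₂) :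
    (scaleCLE a b ha hb v + boxShiftVec m ι₂ a) (Sum.inr j) = b * v.2 j + 1 / 2 := by
  rw [PiLp.add_apply, scaleCLE_apply_inr, boxShiftVec_inr]

/-- The affine box map is smooth (componentwise affine). [folklore] -/
theorem contDiff_boxCoords {a b : ℝ} (ha : a ≠ 0) (hb : b ≠ 0) :
    ContDiff ℝ ∞ fun v : OrthSpace m ι₂ => scaleCLE a b ha hb v + boxShiftVec m ι₂ a := by
  refine contDiff_piLp' 2 fun c => ?_
  rcases c with i | j
  · simp only [boxCoord_inl]
    exact (contDiff_const.mul ((contDiff_apply ℝ ℝ i).comp contDiff_fst)).add contDiff_const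
  · simp only [boxCoord_inr]
    exact (contDiff_const.mul ((contDiff_piLp_apply 2).comp contDiff_snd)).add contDiff_const

/-- The `u`-scale `a_R = 1 / (2 (e^R + 2))`. [folklore] -/
def boxA (R : ℝ) : ℝ := 1 / (2 * (Real.exp R + 2))

/-- The `q`-scale `b_R = 1 / (4 (R + 2))`. [folklore] -/
def boxB (R : ℝ) : ℝ := 1 / (4 * (R + 2))

/-- `a_R > 0`. [folklore] -/
theorem boxA_pos (R : ℝ) : 0 < boxA R := by unfold boxA; positivity

/-- `a_R (e^R + 2) = ½`. [folklore] -/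
theorem boxA_mul (R : ℝ) : boxA R * (Real.exp R + 2) = 1 / 2 := by
  unfold boxA
  have : 0 < Real.exp R + 2 := by positivity
  field_simp

/-- `a_R ≤ ¼`. [folklore] -/
theorem boxA_le (R : ℝ) : boxA R ≤ 1 / 4 := by
  unfold boxA
  rw [div_le_div_iff₀ (by positivity) (by norm_num)]
  nlinarith [Real.exp_pos R]

/-- `b_R > 0` for `R ≥ 0`. [folklore] -/
theorem boxB_pos {R : ℝ} (hR : 0 ≤ R) : 0 < boxB R := by unfold boxB; positivity

/-- `b_R (R + 2) = ¼` for `R ≥ 0`. [folklore] -/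
theorem boxB_mul {R : ℝ} (hR : 0 ≤ R) : boxB R * (R + 2) = 1 / 4 := by
  unfold boxB
  have : 0 < R + 2 := by linarith
  field_simp

/-- The one-dimensional `u`-cutoff: `1` on `[-½, e^R + ½]`, supported in `[-1, e^R + 1]`. [folklore] -/
def bumpU (R : ℝ) : ContDiffBump (Real.exp R / 2) :=
  ⟨Real.exp R / 2 + 1 / 2, Real.exp R / 2 + 1, by positivity, by linarith⟩

/-- The `q`-cutoff: `1` on `B̄(0, |R| + 1)`, supported in `B̄(0, |R| + 2)`. [folklore] -/
def bumpQ (R : ℝ) : ContDiffBump (0 : EuclideanSpace ℝ ι₂) :=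
  ⟨|R| + 1, |R| + 2, by positivity, by linarith⟩

/-- `bumpU = 1` on `[-½, e^R + ½]`. [folklore] -/
theorem bumpU_eq_one {R u : ℝ} (h1 : -(1 / 2 : ℝ) ≤ u) (h2 : u ≤ Real.exp R + 1 / 2) : bumpU R u = 1 := by
  refine (bumpU R).one_of_mem_closedBall ?_
  rw [Metric.mem_closedBall, Real.dist_eq, abs_le]
  simp only [bumpU]
  constructor <;> linarith

/-- `bumpU` vanishes off `(-1, e^R + 1)`. [folklore] -/
theorem bumpU_support {R u : ℝ} (h : bumpU R u ≠ 0) : -1 < u ∧ u < Real.exp R + 1 := by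
  have hmem : u ∈ Function.support (bumpU R : ℝ → ℝ) := h
  rw [(bumpU R).support_eq, Metric.mem_ball, Real.dist_eq, abs_lt] at hmem
  simp only [bumpU] at hmem
  constructor <;> linarith [hmem.1, hmem.2]

variable (m ι₂) in
/-- The cut-off `P(u, q) = (∏ᵢ bumpU(uᵢ)) · bumpQ(q)` of the Fourier engine. [folklore] -/
def cutP (R : ℝ) : OrthSpace m ι₂ → ℂ :=
  fun v => (((∏ i, bumpU R (v.1 i)) * bumpQ (ι₂ := ι₂) R v.2 : ℝ) : ℂ)

/-- `P` is smooth. [folklore] -/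
theorem contDiff_cutP (R : ℝ) : ContDiff ℝ ∞ (cutP m ι₂ R) := by
  unfold cutP
  refine Complex.ofRealCLM.contDiff.comp (ContDiff.mul ?_ ((bumpQ R).contDiff.comp contDiff_snd))
  exact contDiff_prod fun i _ => (bumpU R).contDiff.comp ((contDiff_apply ℝ ℝ i).comp contDiff_fst)

variable (m ι₂) in
/-- The compact box `[-1, e^R + 1]^m × B̄(0, |R| + 2)` carrying `P`. [folklore] -/
def cutBox (R : ℝ) : Set (OrthSpace m ι₂) :=
  (Set.univ.pi fun _ : Fin m => Icc (-1) (Real.exp R + 1)) ×ˢ Metric.closedBall 0 (|R| + 2)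

/-- `P` vanishes off `cutBox`. [folklore] -/
theorem cutP_eq_zero_of_notMem {R : ℝ} {v : OrthSpace m ι₂} (hv : v ∉ cutBox m ι₂ R) : cutP m ι₂ R v = 0 := by
  unfold cutP
  by_contra h
  rw [Complex.ofReal_eq_zero, mul_eq_zero, not_or] at h
  refine hv ⟨fun i _ => ?_, ?_⟩
  · have hi : bumpU R (v.1 i) ≠ 0 := fun h0 => h.1 (Finset.prod_eq_zero (Finset.mem_univ i) h0)
    exact ⟨(bumpU_support hi).1.le, (bumpU_support hi).2.le⟩
  · have hq : v.2 ∈ Function.support (bumpQ (ι₂ := ι₂) R : EuclideanSpace ℝ ι₂ → ℝ) := h.2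
    rw [(bumpQ R).support_eq] at hq
    simp only [bumpQ] at hq
    exact Metric.ball_subset_closedBall hq

/-- `tsupport P ⊆ cutBox`. [folklore] -/
theorem tsupport_cutP_subset (R : ℝ) : tsupport (cutP m ι₂ R) ⊆ cutBox m ι₂ R :=
  closure_minimal (fun _ hv => by_contra fun h => hv (cutP_eq_zero_of_notMem h))
    (((isCompact_univ_pi fun _ => isCompact_Icc).prod (isCompact_closedBall _ _)).isClosed)

/-- `P` has compact support. [folklore] -/
theorem hasCompactSupport_cutP (R : ℝ) : HasCompactSupport (cutP m ι₂ R) :=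
  HasCompactSupport.intro ((isCompact_univ_pi fun _ => isCompact_Icc).prod (isCompact_closedBall _ _))
    fun _ hv => cutP_eq_zero_of_notMem hv

/-- `P = 1` on the box `[e^{-R}, e^R]^m × B̄(0, R)` carrying `Ψ`. [folklore] -/
theorem cutP_eq_one {R : ℝ} {v : OrthSpace m ι₂} (hv : v ∈ pullbackBox R) : cutP m ι₂ R v = 1 := by
  unfold cutP
  have h1 : ∀ i, bumpU R (v.1 i) = 1 := fun i => by
    have hi := hv.1 i (Set.mem_univ _)
    rw [mem_Icc] at hi
    exact bumpU_eq_one (by linarith [Real.exp_pos (-R)]) (by linarith)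
  have h2 : bumpQ (ι₂ := ι₂) R v.2 = 1 := by
    refine (bumpQ R).one_of_mem_closedBall ?_
    have hq := hv.2
    rw [Metric.mem_closedBall] at hq ⊢
    simp only [bumpQ]
    linarith [le_abs_self R]
  simp [h1, h2]

variable (m ι₂) in
/-- The Schwartz cut-off `P`. [folklore] -/
def cutPS (R : ℝ) : 𝓢(OrthSpace m ι₂, ℂ) := (hasCompactSupport_cutP R).toSchwartzMap (contDiff_cutP R)

/-- The terms `Qₙ = P · eₙ(L · + w)` of the Fourier engine. [folklore] -/
def charQFun (R a b : ℝ) (ha : a ≠ 0) (hb : b ≠ 0) (n : Fin m ⊕ ι₂ → ℤ) : OrthSpace m ι₂ → ℂ :=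
  fun v => cutP m ι₂ R v * eChar n (scaleCLE a b ha hb v + boxShiftVec m ι₂ a)

/-- `Qₙ` is smooth. [folklore] -/
theorem contDiff_charQFun (R a b : ℝ) (ha : a ≠ 0) (hb : b ≠ 0) (n : Fin m ⊕ ι₂ → ℤ) :
    ContDiff ℝ ∞ (charQFun R a b ha hb n) := by
  unfold charQFun
  exact (contDiff_cutP R).mul ((contDiff_eChar n).comp (contDiff_boxCoords ha hb))

/-- `Qₙ` has compact support. [folklore] -/
theorem hasCompactSupport_charQFun (R a b : ℝ) (ha : a ≠ 0) (hb : b ≠ 0) (n : Fin m ⊕ ι₂ → ℤ) :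
    HasCompactSupport (charQFun R a b ha hb n) :=
  (hasCompactSupport_cutP R).mul_right

/-- The Schwartz terms `Qₙ`. [folklore] -/
def charQS (R a b : ℝ) (ha : a ≠ 0) (hb : b ≠ 0) (n : Fin m ⊕ ι₂ → ℤ) : 𝓢(OrthSpace m ι₂, ℂ) :=
  (hasCompactSupport_charQFun R a b ha hb n).toSchwartzMap (contDiff_charQFun R a b ha hb n)

/-- **The Fourier engine applied to `Ψ`**: for `R ≥ 0` and `supp φ ⊆ B̄(0, R)`, with
`L = scaleCLE a_R b_R`, `w = boxShiftVec a_R`, the partial sums `∑_{n ∈ s} c_n(Ψ) Qₙ` converge to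
the Schwartz function `Ψ` in `𝓢(V)` (`tendsto_sum_boxCoeff_smul` with `δ = a_R`). [folklore] -/
theorem tendsto_sum_charQS {R : ℝ} (hR : 0 ≤ R) {φ : OrthSpace m ι₂ → ℂ} (hφ : ContDiff ℝ ∞ φ)
    (hφR : tsupport φ ⊆ Metric.closedBall 0 R) :
    Tendsto (fun s : Finset (Fin m ⊕ ι₂ → ℤ) => ∑ n ∈ s,
        boxCoeff (scaleCLE (boxA R) (boxB R) (boxA_pos R).ne' (boxB_pos hR).ne') (boxShiftVec m ι₂ (boxA R))
          ((hasCompactSupport_pullback hφR).toSchwartzMap (contDiff_pullback hφ R)) n •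
        charQS R (boxA R) (boxB R) (boxA_pos R).ne' (boxB_pos hR).ne' n)
      atTop (𝓝 ((hasCompactSupport_pullback hφR).toSchwartzMap (contDiff_pullback hφ R))) := by
  set L := scaleCLE (m := m) (ι₂ := ι₂) (boxA R) (boxB R) (boxA_pos R).ne' (boxB_pos hR).ne' with hL
  set w := boxShiftVec m ι₂ (boxA R) with hw
  set Ψ : 𝓢(OrthSpace m ι₂, ℂ) := (hasCompactSupport_pullback hφR).toSchwartzMap (contDiff_pullback hφ R)
  have hA := boxA_pos R
  have hA4 := boxA_le R
  have hAm := boxA_mul R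
  have hBm := boxB_mul hR
  have hB := boxB_pos hR
  refine tendsto_sum_boxCoeff_smul L w hA Ψ (cutPS m ι₂ R) ?_ ?_ ?_ _ fun n v => rfl
  · -- `Ψ` is supported where all coordinates lie in `[a, 1 - a]`
    intro v hv c
    have hbox : v ∈ pullbackBox R := tsupport_pullback_subset hφR hv
    rcases c with i | j
    · have hi := hbox.1 i (Set.mem_univ _)
      rw [mem_Icc] at hi
      rw [hL, hw, boxCoord_inl]
      constructor
      · nlinarith [Real.exp_pos (-R), hi.1]
      · nlinarith [hi.2]
    · have hq : ‖v.2‖ ≤ R := by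
        have := hbox.2; rwa [Metric.mem_closedBall, dist_zero_right] at this
      have hj : |v.2 j| ≤ R := ((Real.norm_eq_abs _).symm.le.trans (PiLp.norm_apply_le v.2 j)).trans hq
      rw [hL, hw, boxCoord_inr]
      rw [abs_le] at hj
      constructor <;> nlinarith [hj.1, hj.2]
  · intro v hv
    exact cutP_eq_one (tsupport_pullback_subset hφR hv)
  · intro v hv c
    have hbox : v ∈ cutBox m ι₂ R := tsupport_cutP_subset R hv
    rcases c with i | j
    · have hi := hbox.1 i (Set.mem_univ _)
      rw [mem_Icc] at hi
      rw [hL, hw, boxCoord_inl]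
      constructor <;> nlinarith [hi.1, hi.2]
    · have hq : ‖v.2‖ ≤ |R| + 2 := by
        have := hbox.2; rwa [Metric.mem_closedBall, dist_zero_right] at this
      rw [abs_of_nonneg hR] at hq
      have hj : |v.2 j| ≤ R + 2 := ((Real.norm_eq_abs _).symm.le.trans (PiLp.norm_apply_le v.2 j)).trans hq
      rw [hL, hw, boxCoord_inr]
      rw [abs_le] at hj
      constructor <;> nlinarith [hj.1, hj.2]

end Box

/-! ### Factorisation of the characters and the truncated approximant -/

section Trunc

/-- The `u`-part of the exponent: `ℓₙ(v) = 2π a ∑ᵢ nᵢ uᵢ`. [folklore] -/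
def uLin (a : ℝ) (n : Fin m ⊕ ι₂ → ℤ) : OrthSpace m ι₂ →L[ℝ] ℝ :=
  ∑ i : Fin m, (2 * Real.pi * a * (n (Sum.inl i) : ℝ)) •
    ((ContinuousLinearMap.proj (R := ℝ) (φ := fun _ : Fin m => ℝ) i).comp
      (ContinuousLinearMap.fst ℝ (Fin m → ℝ) (EuclideanSpace ℝ ι₂)))

omit [Fintype ι₂] in
/-- `ℓₙ(v) = ∑ᵢ 2π a nᵢ uᵢ`. [folklore] -/
@[simp] theorem uLin_apply (a : ℝ) (n : Fin m ⊕ ι₂ → ℤ) (v : OrthSpace m ι₂) :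
    uLin a n v = ∑ i, 2 * Real.pi * a * (n (Sum.inl i) : ℝ) * v.1 i := by
  simp [uLin, mul_assoc]

variable (m ι₂) in
/-- The `ℓ¹`-size `∑ᵢ 2π |a| |nᵢ|` of the `u`-frequencies, bounding `‖ℓₙ‖` and `|ℓₙ(v)|` on the unit
cube. [folklore] -/
def uSize (a : ℝ) (n : Fin m ⊕ ι₂ → ℤ) : ℝ := ∑ i : Fin m, 2 * Real.pi * |a| * |(n (Sum.inl i) : ℝ)|

omit [Fintype ι₂] in
/-- `uSize ≥ 0`. [folklore] -/
theorem uSize_nonneg (a : ℝ) (n : Fin m ⊕ ι₂ → ℤ) : 0 ≤ uSize m ι₂ a n :=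
  Finset.sum_nonneg fun i _ => by positivity

/-- `‖ℓₙ‖ ≤ uSize`. [folklore] -/
theorem norm_uLin_le (a : ℝ) (n : Fin m ⊕ ι₂ → ℤ) : ‖uLin (ι₂ := ι₂) a n‖ ≤ uSize m ι₂ a n := by
  refine ContinuousLinearMap.opNorm_le_bound _ (uSize_nonneg a n) fun v => ?_
  rw [uLin_apply, uSize, Finset.sum_mul, Real.norm_eq_abs]
  refine (Finset.abs_sum_le_sum_abs _ _).trans (Finset.sum_le_sum fun i _ => ?_)
  rw [abs_mul, abs_mul, abs_mul, abs_of_pos Real.two_pi_pos]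
  have h1 : |v.1 i| ≤ ‖v‖ :=
    ((Real.norm_eq_abs _).symm.le.trans (norm_le_pi_norm v.1 i)).trans (norm_fst_le v)
  have h2 : 0 ≤ 2 * Real.pi * |a| * |(n (Sum.inl i) : ℝ)| := by positivity
  exact mul_le_mul_of_nonneg_left h1 h2

omit [Fintype ι₂] in
/-- `|ℓₙ(v)| ≤ uSize` when `|uᵢ| ≤ 1`. [folklore] -/
theorem abs_uLin_le {a : ℝ} {n : Fin m ⊕ ι₂ → ℤ} {v : OrthSpace m ι₂} (hv : ∀ i, |v.1 i| ≤ 1) :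
    |uLin a n v| ≤ uSize m ι₂ a n := by
  rw [uLin_apply, uSize]
  refine (Finset.abs_sum_le_sum_abs _ _).trans (Finset.sum_le_sum fun i _ => ?_)
  rw [abs_mul, abs_mul, abs_mul, abs_of_pos Real.two_pi_pos]
  have h2 : 0 ≤ 2 * Real.pi * |a| * |(n (Sum.inl i) : ℝ)| := by positivity
  calc 2 * Real.pi * |a| * |(n (Sum.inl i) : ℝ)| * |v.1 i|
      ≤ 2 * Real.pi * |a| * |(n (Sum.inl i) : ℝ)| * 1 := mul_le_mul_of_nonneg_left (hv i) h2
    _ = _ := mul_one _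

/-- The constant phase `e^{2πi · 2a ∑ᵢ nᵢ}` of the `u`-characters. [folklore] -/
def uPhase (a : ℝ) (n : Fin m ⊕ ι₂ → ℤ) : ℂ := (𝐞 (2 * a * ∑ i : Fin m, (n (Sum.inl i) : ℝ)) : ℂ)

omit [Fintype ι₂] in
/-- `|uPhase| = 1`. [folklore] -/
@[simp] theorem norm_uPhase (a : ℝ) (n : Fin m ⊕ ι₂ → ℤ) : ‖uPhase (ι₂ := ι₂) a n‖ = 1 := Circle.norm_coe _

/-- The `q`-characters `e^{2πi ∑ⱼ nⱼ (b qⱼ + ½)}`. [folklore] -/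
def qChar (b : ℝ) (n : Fin m ⊕ ι₂ → ℤ) : EuclideanSpace ℝ ι₂ → ℂ :=
  fun q => (𝐞 (∑ j, (n (Sum.inr j) : ℝ) * (b * q j + 1 / 2)) : ℂ)

/-- The `q`-characters are smooth. [folklore] -/
theorem contDiff_qChar (b : ℝ) (n : Fin m ⊕ ι₂ → ℤ) : ContDiff ℝ ∞ (qChar b n) := by
  unfold qChar
  refine contDiff_fourierChar.comp (ContDiff.sum fun j _ => contDiff_const.mul ?_)
  exact (contDiff_const.mul (contDiff_piLp_apply 2)).add contDiff_const

/-- **Factorisation of the engine's characters in the block coordinates**: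
`eₙ(L v + w) = uPhase · e^{i ℓₙ(v)} · qChar(v₂)`. [folklore] -/
theorem eChar_boxCoords {a b : ℝ} (ha : a ≠ 0) (hb : b ≠ 0) (n : Fin m ⊕ ι₂ → ℤ) (v : OrthSpace m ι₂) :
    eChar n (scaleCLE a b ha hb v + boxShiftVec m ι₂ a) = uPhase a n * expI (uLin a n v) * qChar b n v.2 := by
  rw [eChar, intForm_apply, Fintype.sum_sum_type]
  simp only [boxCoord_inl, boxCoord_inr]
  have hsplit : ∑ i : Fin m, (n (Sum.inl i) : ℝ) * (a * v.1 i + 2 * a) =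
      (2 * a * ∑ i : Fin m, (n (Sum.inl i) : ℝ)) + ∑ i, a * (n (Sum.inl i) : ℝ) * v.1 i := by
    rw [Finset.mul_sum, ← Finset.sum_add_distrib]
    refine Finset.sum_congr rfl fun i _ => ?_
    ring
  rw [hsplit, AddChar.map_add_eq_mul, AddChar.map_add_eq_mul, Circle.coe_mul, Circle.coe_mul]
  unfold uPhase qChar
  congr 1
  congr 1
  rw [Real.fourierChar_apply, expI, uLin_apply]
  congr 1
  push_cast
  rw [Finset.mul_sum]
  congr 1
  refine Finset.sum_congr rfl fun i _ => ?_
  ring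

/-- The `q`-parts `ψₙ(q) = bumpQ(q) · qChar(q)`: smooth and compactly supported. [folklore] -/
def qPart (R b : ℝ) (n : Fin m ⊕ ι₂ → ℤ) : EuclideanSpace ℝ ι₂ → ℂ :=
  fun q => (bumpQ (ι₂ := ι₂) R q : ℂ) * qChar b n q

/-- `ψₙ` is smooth. [folklore] -/
theorem contDiff_qPart (R b : ℝ) (n : Fin m ⊕ ι₂ → ℤ) : ContDiff ℝ ∞ (qPart (ι₂ := ι₂) R b n) :=
  (Complex.ofRealCLM.contDiff.comp (bumpQ R).contDiff).mul (contDiff_qChar b n)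

/-- `ψₙ` has compact support. [folklore] -/
theorem hasCompactSupport_qPart (R b : ℝ) (n : Fin m ⊕ ι₂ → ℤ) : HasCompactSupport (qPart (ι₂ := ι₂) R b n) := by
  refine HasCompactSupport.mul_right ?_
  exact (bumpQ (ι₂ := ι₂) R).hasCompactSupport.comp_left Complex.ofReal_zero

/-- `ψₙ` vanishes off `B̄(0, |R| + 2)`. [folklore] -/
theorem qPart_eq_zero {R b : ℝ} {n : Fin m ⊕ ι₂ → ℤ} {q : EuclideanSpace ℝ ι₂} (hq : |R| + 2 ≤ ‖q‖) :
    qPart R b n q = 0 := by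
  unfold qPart
  rw [(bumpQ R).zero_of_le_dist (by simpa [bumpQ] using hq), Complex.ofReal_zero, zero_mul]

/-- **The engine's terms in factorised form**:
`Qₙ(v) = (∏ᵢ bumpU(uᵢ)) · (uPhase e^{iℓₙ(v)}) · ψₙ(v₂)`. [folklore] -/
theorem charQFun_eq {R a b : ℝ} (ha : a ≠ 0) (hb : b ≠ 0) (n : Fin m ⊕ ι₂ → ℤ) (v : OrthSpace m ι₂) :
    charQFun R a b ha hb n v =
      ((∏ i, bumpU R (v.1 i) : ℝ) : ℂ) * (uPhase a n * expI (uLin a n v)) * qPart R b n v.2 := by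
  rw [charQFun, eChar_boxCoords, cutP, qPart]
  push_cast
  ring

/-- The clean sum `∑ₙ cₙ uPhase e^{iℓₙ(v)} ψₙ(v₂)` (the engine's partial sum with the `u`-cutoff
removed). [folklore] -/
def cleanSum (R a b : ℝ) (s : Finset (Fin m ⊕ ι₂ → ℤ)) (c : (Fin m ⊕ ι₂ → ℤ) → ℂ) :
    OrthSpace m ι₂ → ℂ :=
  fun v => ∑ n ∈ s, c n * (uPhase a n * expI (uLin a n v)) * qPart R b n v.2

/-- The truncated sum `∑ₙ cₙ uPhase T_N(ℓₙ(v)) ψₙ(v₂)` (characters replaced by Taylor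
polynomials). [folklore] -/
def truncSum (R a b : ℝ) (s : Finset (Fin m ⊕ ι₂ → ℤ)) (c : (Fin m ⊕ ι₂ → ℤ) → ℂ) (N : ℕ) :
    OrthSpace m ι₂ → ℂ :=
  fun v => ∑ n ∈ s, c n * (uPhase a n * expTrunc N (uLin a n v)) * qPart R b n v.2

/-- The engine's partial sum `∑ₙ cₙ Qₙ` as a function. [folklore] -/
def engineSum (R a b : ℝ) (ha : a ≠ 0) (hb : b ≠ 0) (s : Finset (Fin m ⊕ ι₂ → ℤ))
    (c : (Fin m ⊕ ι₂ → ℤ) → ℂ) : OrthSpace m ι₂ → ℂ :=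
  fun v => ∑ n ∈ s, c n * charQFun R a b ha hb n v

/-- `engineSum − cleanSum = ((∏ bumpU) − 1) · cleanSum`. [folklore] -/
theorem engineSum_sub_cleanSum {R a b : ℝ} (ha : a ≠ 0) (hb : b ≠ 0) (s : Finset (Fin m ⊕ ι₂ → ℤ))
    (c : (Fin m ⊕ ι₂ → ℤ) → ℂ) (v : OrthSpace m ι₂) :
    engineSum R a b ha hb s c v - cleanSum R a b s c v =
      (((∏ i, bumpU R (v.1 i) : ℝ) : ℂ) - 1) * cleanSum R a b s c v := by
  simp only [engineSum, cleanSum, charQFun_eq ha hb, Finset.mul_sum, ← Finset.sum_sub_distrib]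
  refine Finset.sum_congr rfl fun n _ => ?_
  ring

/-- `cleanSum − truncSum = ∑ₙ cₙ uPhase · expTail_N(ℓₙ) · ψₙ`. [folklore] -/
theorem cleanSum_sub_truncSum (R a b : ℝ) (s : Finset (Fin m ⊕ ι₂ → ℤ)) (c : (Fin m ⊕ ι₂ → ℤ) → ℂ)
    (N : ℕ) (v : OrthSpace m ι₂) :
    cleanSum R a b s c v - truncSum R a b s c N v =
      ∑ n ∈ s, c n * uPhase a n * (expTail N (uLin a n v) * qPart R b n v.2) := by
  simp only [cleanSum, truncSum, ← Finset.sum_sub_distrib, expTail]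
  refine Finset.sum_congr rfl fun n _ => ?_
  ring

/-- **The exponential-sum approximant** `G = [(∏ᵢ uᵢ) · truncSum] ∘ expNegMap`. [folklore] -/
def approxG (R a b : ℝ) (s : Finset (Fin m ⊕ ι₂ → ℤ)) (c : (Fin m ⊕ ι₂ → ℤ) → ℂ) (N : ℕ) :
    OrthSpace m ι₂ → ℂ :=
  fun x => ((∏ i, (expNegMap m (EuclideanSpace ℝ ι₂) x).1 i : ℝ) : ℂ) *
    truncSum R a b s c N (expNegMap m (EuclideanSpace ℝ ι₂) x)

/-- **`G` is an exponential sum** with rates in `[1, ∞)^m`: expanding the Taylor polynomials,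
`G = ∑ₙ ∑_{l ≤ N} cₙ uPhase i^l/l! · (∏ᵢ e^{-σᵢ}) (∑ᵢ βₙᵢ e^{-σᵢ})^l ψₙ(q)`. [folklore] -/
theorem approxG_mem (R a b : ℝ) (s : Finset (Fin m ⊕ ι₂ → ℤ)) (c : (Fin m ⊕ ι₂ → ℤ) → ℂ) (N : ℕ) :
    approxG R a b s c N ∈ expSumSpan m ι₂ := by
  have hrepr : approxG R a b s c N = ∑ n ∈ s, ∑ l ∈ Finset.range (N + 1),
      (c n * uPhase a n * (I ^ l / (l.factorial : ℂ))) •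
        fun x : OrthSpace m ι₂ =>
          (((∑ i, (2 * Real.pi * a * (n (Sum.inl i) : ℝ)) * Real.exp (-(x.1 i)) : ℝ) : ℂ) ^ l *
            (((∏ i, Real.exp (-(x.1 i)) : ℝ) : ℂ) * qPart R b n x.2)) := by
    funext x
    simp only [approxG, truncSum, expTrunc, Finset.sum_apply, Pi.smul_apply, smul_eq_mul,
      expNegMap_fst, expNegMap_snd, uLin_apply, Finset.mul_sum]
    refine Finset.sum_congr rfl fun n _ => ?_
    rw [Finset.sum_mul, Finset.mul_sum]
    refine Finset.sum_congr rfl fun l _ => ?_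
    rw [mul_pow]
    push_cast
    ring
  rw [hrepr]
  refine Submodule.sum_mem _ fun n _ => Submodule.sum_mem _ fun l _ => Submodule.smul_mem _ _ ?_
  exact linExp_pow_mul_mem _ l (prodExp_mul_mem (contDiff_qPart R b n) (hasCompactSupport_qPart R b n))

/-- `G` is smooth. [folklore] -/
theorem contDiff_approxG (R a b : ℝ) (s : Finset (Fin m ⊕ ι₂ → ℤ)) (c : (Fin m ⊕ ι₂ → ℤ) → ℂ) (N : ℕ) :
    ContDiff ℝ ∞ (approxG R a b s c N) :=
  contDiff_of_mem_expSumSpan (approxG_mem R a b s c N)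

end Trunc

/-! ### Jets: general bookkeeping with `dsup` -/

section Dsup

variable {E : Type*} [NormedAddCommGroup E] [NormedSpace ℝ E]
variable {F : Type*} [NormedAddCommGroup F] [NormedSpace ℝ F]

/-- Triangle inequality for jets. [folklore] -/
theorem dsup_add_le {f g : E → F} (hf : ContDiff ℝ ∞ f) (hg : ContDiff ℝ ∞ g) (n : ℕ) (x : E) :
    dsup n (fun y => f y + g y) x ≤ dsup n f x + dsup n g x := by
  refine dsup_le_iff.2 fun i hi => ?_
  have h := iteratedFDeriv_add_apply (i := i) (hf.contDiffAt.of_le (mod_cast le_top))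
    (hg.contDiffAt.of_le (mod_cast le_top)) (x := x)
  rw [show (fun y => f y + g y) = f + g from rfl, h]
  exact (norm_add_le _ _).trans (add_le_add (norm_iteratedFDeriv_le_dsup hi f x)
    (norm_iteratedFDeriv_le_dsup hi g x))

/-- Jets of `-f`. [folklore] -/
theorem dsup_neg (n : ℕ) (f : E → F) (x : E) : dsup n (fun y => -f y) x = dsup n f x := by
  simp only [dsup, show (fun y => -f y) = -f from rfl, iteratedFDeriv_neg_apply, norm_neg]

/-- Triangle inequality for jets of a difference. [folklore] -/
theorem dsup_sub_le {f g : E → F} (hf : ContDiff ℝ ∞ f) (hg : ContDiff ℝ ∞ g) (n : ℕ) (x : E) :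
    dsup n (fun y => f y - g y) x ≤ dsup n f x + dsup n g x := by
  have h := dsup_add_le hf hg.neg n x
  rw [dsup_neg] at h
  simpa [sub_eq_add_neg] using h

/-- Jets of finite sums. [folklore] -/
theorem dsup_sum_le {ι : Type*} (s : Finset ι) {f : ι → E → F} (hf : ∀ i ∈ s, ContDiff ℝ ∞ (f i))
    (n : ℕ) (x : E) : dsup n (fun y => ∑ i ∈ s, f i y) x ≤ ∑ i ∈ s, dsup n (f i) x := by
  refine dsup_le_iff.2 fun j hj => ?_
  rw [iteratedFDeriv_fun_sum_apply fun i hi => (hf i hi).contDiffAt.of_le (mod_cast le_top)]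
  exact (norm_sum_le _ _).trans (Finset.sum_le_sum fun i _ => norm_iteratedFDeriv_le_dsup hj _ x)

/-- Jets of a constant multiple. [folklore] -/
theorem dsup_const_mul_le (c : ℂ) {f : E → ℂ} (hf : ContDiff ℝ ∞ f) (n : ℕ) (x : E) :
    dsup n (fun y => c * f y) x ≤ ‖c‖ * dsup n f x := by
  refine dsup_le_iff.2 fun i hi => ?_
  have h : (fun y => c * f y) = c • f := by funext y; rfl
  rw [h, iteratedFDeriv_const_smul_apply (hf.contDiffAt.of_le (mod_cast le_top)), norm_smul]
  exact mul_le_mul_of_nonneg_left (norm_iteratedFDeriv_le_dsup hi f x) (norm_nonneg _)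

/-- Jets after the real-to-complex embedding. [folklore] -/
theorem dsup_ofReal_comp {f : E → ℝ} (hf : ContDiff ℝ ∞ f) (n : ℕ) (x : E) :
    dsup n (fun y => (f y : ℂ)) x = dsup n f x := by
  simp only [dsup]
  congr 1
  funext i
  exact Complex.ofRealLI.norm_iteratedFDeriv_comp_left (hf.contDiffAt (x := x)) (i := i) (mod_cast le_top)

/-- Jets of a compactly supported smooth function are uniformly bounded. [folklore] -/
theorem exists_dsup_le_of_hasCompactSupport {f : E → ℂ} (hf : ContDiff ℝ ∞ f)
    (hc : HasCompactSupport f) (n : ℕ) : ∃ M : ℝ, 0 ≤ M ∧ ∀ x, dsup n f x ≤ M := by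
  have hb : ∀ i : ℕ, ∃ C, ∀ x, ‖iteratedFDeriv ℝ i f x‖ ≤ C := fun i =>
    ((hf.of_le (mod_cast le_top) : ContDiff ℝ i f).continuous_iteratedFDeriv').bounded_above_of_compact_support
      (hc.iteratedFDeriv i)
  choose C hC using hb
  refine ⟨∑ i ∈ Finset.range (n + 1), |C i|, Finset.sum_nonneg fun i _ => abs_nonneg _, fun x => ?_⟩
  refine dsup_le_iff.2 fun i hi => ((hC i x).trans (le_abs_self _)).trans ?_
  exact Finset.single_le_sum (f := fun i => |C i|) (fun i _ => abs_nonneg _)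
    (Finset.mem_range.2 (Nat.lt_succ_of_le hi))

end Dsup

/-! ### Jets: the specific functions -/

section Jets

/-- Jets through the first projection: `dsup n (f ∘ fst) (v) ≤ dsup n f (v₁)`. [folklore] -/
theorem dsup_comp_fst_le {F' : Type*} [NormedAddCommGroup F'] [NormedSpace ℝ F'] {f : (Fin m → ℝ) → F'}
    (hf : ContDiff ℝ ∞ f) (n : ℕ) (v : OrthSpace m ι₂) :
    dsup n (fun y : OrthSpace m ι₂ => f y.1) v ≤ dsup n f v.1 := by
  refine dsup_le_iff.2 fun i hi => ?_
  have hcomp : (fun y : OrthSpace m ι₂ => f y.1) = f ∘ (ContinuousLinearMap.fst ℝ (Fin m → ℝ) (EuclideanSpace ℝ ι₂)) := rfl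
  rw [hcomp, ContinuousLinearMap.iteratedFDeriv_comp_right _ hf v (i := i) (mod_cast le_top)]
  refine (ContinuousMultilinearMap.norm_compContinuousLinearMap_le _ _).trans ?_
  rw [Finset.prod_const, Finset.card_univ, Fintype.card_fin]
  calc ‖iteratedFDeriv ℝ i f ((ContinuousLinearMap.fst ℝ (Fin m → ℝ) (EuclideanSpace ℝ ι₂)) v)‖ *
        ‖ContinuousLinearMap.fst ℝ (Fin m → ℝ) (EuclideanSpace ℝ ι₂)‖ ^ i
      ≤ dsup n f v.1 * 1 := by
        gcongr
        · exact dsup_nonneg n f v.1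
        · exact norm_iteratedFDeriv_le_dsup hi f v.1
        · exact pow_le_one₀ (norm_nonneg _) (ContinuousLinearMap.norm_fst_le ℝ _ _)
    _ = dsup n f v.1 := mul_one _

/-- Jets through the second projection: `dsup n (f ∘ snd) (v) ≤ dsup n f (v₂)`. [folklore] -/
theorem dsup_comp_snd_le {F' : Type*} [NormedAddCommGroup F'] [NormedSpace ℝ F'] {f : EuclideanSpace ℝ ι₂ → F'}
    (hf : ContDiff ℝ ∞ f) (n : ℕ) (v : OrthSpace m ι₂) :
    dsup n (fun y : OrthSpace m ι₂ => f y.2) v ≤ dsup n f v.2 := by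
  refine dsup_le_iff.2 fun i hi => ?_
  have hcomp : (fun y : OrthSpace m ι₂ => f y.2) = f ∘ (ContinuousLinearMap.snd ℝ (Fin m → ℝ) (EuclideanSpace ℝ ι₂)) := rfl
  rw [hcomp, ContinuousLinearMap.iteratedFDeriv_comp_right _ hf v (i := i) (mod_cast le_top)]
  refine (ContinuousMultilinearMap.norm_compContinuousLinearMap_le _ _).trans ?_
  rw [Finset.prod_const, Finset.card_univ, Fintype.card_fin]
  calc ‖iteratedFDeriv ℝ i f ((ContinuousLinearMap.snd ℝ (Fin m → ℝ) (EuclideanSpace ℝ ι₂)) v)‖ *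
        ‖ContinuousLinearMap.snd ℝ (Fin m → ℝ) (EuclideanSpace ℝ ι₂)‖ ^ i
      ≤ dsup n f v.2 * 1 := by
        gcongr
        · exact dsup_nonneg n f v.2
        · exact norm_iteratedFDeriv_le_dsup hi f v.2
        · exact pow_le_one₀ (norm_nonneg _) (ContinuousLinearMap.norm_snd_le ℝ _ _)
    _ = dsup n f v.2 := mul_one _

/-- **Jets of the coordinate products on the unit cube**: `dsup n (∏_{j∈t} uⱼ) ≤ (n+1)^m`. [folklore] -/
theorem dsup_prodCoord_le (t : Finset (Fin m)) {v : OrthSpace m ι₂} (hv : ∀ i, |v.1 i| ≤ 1) (n : ℕ) :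
    dsup n (fun y : OrthSpace m ι₂ => ((∏ j ∈ t, y.1 j : ℝ) : ℂ)) v ≤ (n + 1 : ℝ) ^ m := by
  have h1 : ContDiff ℝ ∞ fun y : OrthSpace m ι₂ => ∏ j ∈ t, y.1 j :=
    (contDiff_prodCoord t).comp contDiff_fst
  rw [dsup_ofReal_comp h1]
  change dsup n (fun y : OrthSpace m ι₂ => prodCoord t y.1) v ≤ _
  refine (dsup_comp_fst_le (contDiff_prodCoord t) n v).trans ?_
  refine dsup_le_iff.2 fun i hi => (norm_iteratedFDeriv_prodCoord_le t hv i).trans ?_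
  have hi' : (i + 1 : ℝ) ≤ n + 1 := by exact_mod_cast Nat.succ_le_succ hi
  calc (i + 1 : ℝ) ^ t.card ≤ (n + 1 : ℝ) ^ t.card := pow_le_pow_left₀ (by positivity) hi' _
    _ ≤ (n + 1 : ℝ) ^ m := by
        refine pow_le_pow_right₀ (by linarith) ?_
        exact (Finset.card_le_univ t).trans_eq (Fintype.card_fin m)

/-- **Jets of `e^{-σᵢ}`**: `dsup n (e^{-σᵢ}) (x) ≤ e^{-σᵢ}`. [folklore] -/
theorem dsup_expNeg_le (i : Fin m) (n : ℕ) (x : OrthSpace m ι₂) :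
    dsup n (fun y : OrthSpace m ι₂ => ((Real.exp (-(y.1 i)) : ℝ) : ℂ)) x ≤ Real.exp (-(x.1 i)) := by
  have h1 : ContDiff ℝ ∞ fun y : OrthSpace m ι₂ => Real.exp (-(y.1 i)) :=
    Real.contDiff_exp.comp ((contDiff_apply ℝ ℝ i).comp contDiff_fst).neg
  rw [dsup_ofReal_comp h1]
  refine dsup_le_iff.2 fun j _ => ?_
  exact norm_iteratedFDeriv_expNegMap_fst_le (W := EuclideanSpace ℝ ι₂) i j x

/-- **Composition with `expNegMap` costs `n! eⁿ`** on `{σᵢ ≥ -1}` (Faà di Bruno,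
`norm_iteratedFDeriv_comp_le`). [folklore] -/
theorem dsup_comp_expNegMap_le {g : OrthSpace m ι₂ → ℂ} (hg : ContDiff ℝ ∞ g) {x : OrthSpace m ι₂}
    (hx : ∀ i, -1 ≤ x.1 i) (n : ℕ) :
    dsup n (fun y => g (expNegMap m (EuclideanSpace ℝ ι₂) y)) x ≤
      n.factorial * Real.exp 1 ^ n * dsup n g (expNegMap m (EuclideanSpace ℝ ι₂) x) := by
  refine dsup_le_iff.2 fun i hi => ?_
  have h := norm_iteratedFDeriv_comp_le (g := g) (f := expNegMap m (EuclideanSpace ℝ ι₂)) (n := i)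
    (N := (i : ℕ∞)) (hg.of_le (mod_cast le_top)) (contDiff_expNegMap.of_le le_rfl) le_rfl x
    (C := dsup n g (expNegMap m (EuclideanSpace ℝ ι₂) x)) (D := Real.exp 1)
    (fun j hj => norm_iteratedFDeriv_le_dsup (hj.trans hi) g _)
    (fun j hj _ => norm_iteratedFDeriv_expNegMap_le hx hj)
  refine h.trans ?_
  have h0 := dsup_nonneg n g (expNegMap m (EuclideanSpace ℝ ι₂) x)
  have he : 1 ≤ Real.exp 1 := Real.one_le_exp zero_le_one
  calc (i.factorial : ℝ) * dsup n g (expNegMap m (EuclideanSpace ℝ ι₂) x) * Real.exp 1 ^ i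
      ≤ (n.factorial : ℝ) * dsup n g (expNegMap m (EuclideanSpace ℝ ι₂) x) * Real.exp 1 ^ n :=
        mul_le_mul (mul_le_mul_of_nonneg_right (by exact_mod_cast Nat.factorial_le hi) h0)
          (pow_le_pow_right₀ he hi) (by positivity) (by positivity)
    _ = _ := by ring

/-- The `u`-cutoff product is `1` near the closed unit cube: its jets of `(∏ bumpU) - 1` vanish
there. [folklore] -/
theorem dsup_prod_bumpU_sub_one {R : ℝ} (hR : 0 ≤ R) {v : OrthSpace m ι₂}
    (hv : ∀ i, 0 ≤ v.1 i ∧ v.1 i ≤ 1) (n : ℕ) :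
    dsup n (fun y : OrthSpace m ι₂ => ((∏ i, bumpU R (y.1 i) : ℝ) : ℂ) - 1) v = 0 := by
  refine dsup_eq_zero_of_notMem_tsupport ?_
  rw [notMem_tsupport_iff_eventuallyEq]
  -- the function vanishes on the open neighbourhood `{-½ < uᵢ < e^R + ½}` of `v`
  have hO : IsOpen {y : OrthSpace m ι₂ | ∀ i, y.1 i ∈ Ioo (-(1 / 2 : ℝ)) (Real.exp R + 1 / 2)} := by
    have : {y : OrthSpace m ι₂ | ∀ i, y.1 i ∈ Ioo (-(1 / 2 : ℝ)) (Real.exp R + 1 / 2)} =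
        ⋂ i, (fun y : OrthSpace m ι₂ => y.1 i) ⁻¹' Ioo (-(1 / 2 : ℝ)) (Real.exp R + 1 / 2) := by
      ext y; simp
    rw [this]
    exact isOpen_iInter_of_finite fun i => isOpen_Ioo.preimage ((continuous_apply i).comp continuous_fst)
  have hvO : v ∈ {y : OrthSpace m ι₂ | ∀ i, y.1 i ∈ Ioo (-(1 / 2 : ℝ)) (Real.exp R + 1 / 2)} := fun i =>
    ⟨by linarith [(hv i).1], by linarith [(hv i).2, Real.one_le_exp hR]⟩
  filter_upwards [hO.mem_nhds hvO] with y hy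
  have h1 : ∀ i, bumpU R (y.1 i) = 1 := fun i => bumpU_eq_one (hy i).1.le (hy i).2.le
  simp [h1]

end Jets

/-! ### The pointwise estimates -/

section Estimates

variable {R a b : ℝ} {ha : a ≠ 0} {hb : b ≠ 0} {s : Finset (Fin m ⊕ ι₂ → ℤ)}
  {c : (Fin m ⊕ ι₂ → ℤ) → ℂ} {N n₀ : ℕ} {φ : OrthSpace m ι₂ → ℂ} {Λ τ δ₁ Mq : ℝ}

/-- Smoothness of the clean sum. [folklore] -/
theorem contDiff_cleanSum (R a b : ℝ) (s : Finset (Fin m ⊕ ι₂ → ℤ)) (c : (Fin m ⊕ ι₂ → ℤ) → ℂ) :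
    ContDiff ℝ ∞ (cleanSum R a b s c) := by
  unfold cleanSum
  refine ContDiff.sum fun n _ => (contDiff_const.mul (contDiff_const.mul ?_)).mul
    ((contDiff_qPart R b n).comp contDiff_snd)
  exact contDiff_expI.comp (uLin a n).contDiff

/-- Smoothness of the truncated sum. [folklore] -/
theorem contDiff_truncSum (R a b : ℝ) (s : Finset (Fin m ⊕ ι₂ → ℤ)) (c : (Fin m ⊕ ι₂ → ℤ) → ℂ) (N : ℕ) :
    ContDiff ℝ ∞ (truncSum R a b s c N) := by
  unfold truncSum
  refine ContDiff.sum fun n _ => (contDiff_const.mul (contDiff_const.mul ?_)).mul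
    ((contDiff_qPart R b n).comp contDiff_snd)
  exact (contDiff_expTrunc N).comp (uLin a n).contDiff

/-- Smoothness of the engine sum. [folklore] -/
theorem contDiff_engineSum (R a b : ℝ) (ha : a ≠ 0) (hb : b ≠ 0) (s : Finset (Fin m ⊕ ι₂ → ℤ))
    (c : (Fin m ⊕ ι₂ → ℤ) → ℂ) : ContDiff ℝ ∞ (engineSum R a b ha hb s c) := by
  unfold engineSum
  exact ContDiff.sum fun n _ => contDiff_const.mul (contDiff_charQFun R a b ha hb n)

/-- **Jets of the tail terms**: `dsup n₀ (expTail_N ∘ ℓₙ)(v) ≤ τ (max 1 Λ)^{n₀}` on the cube. [folklore] -/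
theorem dsup_expTail_uLin_le {n : Fin m ⊕ ι₂ → ℤ} (hΛn : uSize m ι₂ a n ≤ Λ) (hτ0 : 0 ≤ τ)
    (hτ : ∀ j, j ≤ n₀ → ∀ t : ℝ, |t| ≤ Λ → ‖iteratedDeriv j (expTail N) t‖ ≤ τ)
    {v : OrthSpace m ι₂} (hv : ∀ i, |v.1 i| ≤ 1) :
    dsup n₀ (fun y : OrthSpace m ι₂ => expTail N (uLin a n y)) v ≤ τ * max 1 Λ ^ n₀ := by
  refine dsup_le_iff.2 fun j hj => ?_
  refine (norm_iteratedFDeriv_realComp_clm_le (contDiff_expTail N) (uLin a n) j v).trans ?_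
  have h1 : |uLin a n v| ≤ Λ := (abs_uLin_le hv).trans hΛn
  have h2 : ‖uLin (ι₂ := ι₂) a n‖ ≤ max 1 Λ := ((norm_uLin_le a n).trans hΛn).trans (le_max_right _ _)
  have h3 : (1 : ℝ) ≤ max 1 Λ := le_max_left _ _
  calc ‖iteratedDeriv j (expTail N) (uLin a n v)‖ * ‖uLin (ι₂ := ι₂) a n‖ ^ j
      ≤ τ * max 1 Λ ^ j := mul_le_mul (hτ j hj _ h1) (pow_le_pow_left₀ (norm_nonneg _) h2 j)
          (by positivity) hτ0
    _ ≤ τ * max 1 Λ ^ n₀ := mul_le_mul_of_nonneg_left (pow_le_pow_right₀ h3 hj) hτ0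

/-- **(E1) The three-term estimate at the image points.** On the closed unit cube in `u`,
`dsup n₀ (truncSum − Ψ)(v) ≤ δ₁ + (∑ ‖cₙ‖) · 2^{n₀} τ (max 1 Λ)^{n₀} M_q`: the engine error
(`δ₁`), the `u`-cutoff (invisible near the cube) and the Taylor tails. [folklore] -/
theorem dsup_truncSum_sub_pullback_le (hR : 0 ≤ R) (hφ : ContDiff ℝ ∞ φ)
    (hΛ : ∀ n ∈ s, uSize m ι₂ a n ≤ Λ) (hτ0 : 0 ≤ τ)
    (hτ : ∀ j, j ≤ n₀ → ∀ t : ℝ, |t| ≤ Λ → ‖iteratedDeriv j (expTail N) t‖ ≤ τ)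
    (_hMq0 : 0 ≤ Mq) (hMq : ∀ n ∈ s, ∀ q, dsup n₀ (qPart R b n) q ≤ Mq)
    (hS : ∀ v, dsup n₀ (fun y => engineSum R a b ha hb s c y - pullback φ R y) v ≤ δ₁)
    {v : OrthSpace m ι₂} (hv : ∀ i, 0 ≤ v.1 i ∧ v.1 i ≤ 1) :
    dsup n₀ (fun y => truncSum R a b s c N y - pullback φ R y) v ≤
      δ₁ + (∑ n ∈ s, ‖c n‖) * (2 ^ n₀ * (τ * max 1 Λ ^ n₀) * Mq) := by
  have hv' : ∀ i, |v.1 i| ≤ 1 := fun i => abs_le.2 ⟨by linarith [(hv i).1], (hv i).2⟩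
  have hT := contDiff_truncSum (ι₂ := ι₂) R a b s c N
  have hC := contDiff_cleanSum (ι₂ := ι₂) R a b s c
  have hE := contDiff_engineSum (ι₂ := ι₂) R a b ha hb s c
  have hP := contDiff_pullback hφ R
  -- split `T - P = (T - C) + ((C - E) + (E - P))`
  have hsplit : (fun y => truncSum R a b s c N y - pullback φ R y) =
      fun y => (truncSum R a b s c N y - cleanSum R a b s c y) +
        ((cleanSum R a b s c y - engineSum R a b ha hb s c y) +
          (engineSum R a b ha hb s c y - pullback φ R y)) := by
    funext y; ring
  rw [hsplit]
  refine (dsup_add_le (hT.sub hC) ((hC.sub hE).add (hE.sub hP)) n₀ v).trans ?_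
  refine (add_le_add le_rfl (dsup_add_le (hC.sub hE) (hE.sub hP) n₀ v)).trans ?_
  -- (a) the engine error
  have ha' := hS v
  -- (b) the `u`-cutoff error vanishes
  have hb' : dsup n₀ (fun y => cleanSum R a b s c y - engineSum R a b ha hb s c y) v = 0 := by
    have hfun : (fun y => cleanSum R a b s c y - engineSum R a b ha hb s c y) =
        fun y => -((fun y : OrthSpace m ι₂ => ((∏ i, bumpU R (y.1 i) : ℝ) : ℂ) - 1) y * cleanSum R a b s c y) := by
      funext y
      rw [← engineSum_sub_cleanSum ha hb s c y]
      ring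
    rw [hfun, dsup_neg]
    have hprod : ContDiff ℝ ∞ fun y : OrthSpace m ι₂ => ((∏ i, bumpU R (y.1 i) : ℝ) : ℂ) - 1 := by
      have hprod0 : ContDiff ℝ ∞ fun y : OrthSpace m ι₂ => ∏ i, bumpU R (y.1 i) :=
        contDiff_prod fun i _ => (bumpU R).contDiff.comp ((contDiff_apply ℝ ℝ i).comp contDiff_fst)
      exact (Complex.ofRealCLM.contDiff.comp hprod0).sub contDiff_const
    have hle : dsup n₀ (fun y => (fun y : OrthSpace m ι₂ => ((∏ i, bumpU R (y.1 i) : ℝ) : ℂ) - 1) y *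
        cleanSum R a b s c y) v ≤ 0 := by
      refine (dsup_mul_le hprod hC n₀ v).trans ?_
      rw [dsup_prod_bumpU_sub_one hR hv n₀, mul_zero, zero_mul]
    exact le_antisymm hle (dsup_nonneg _ _ _)
  -- (c) the Taylor tails
  have hc' : dsup n₀ (fun y => truncSum R a b s c N y - cleanSum R a b s c y) v ≤
      (∑ n ∈ s, ‖c n‖) * (2 ^ n₀ * (τ * max 1 Λ ^ n₀) * Mq) := by
    have hfun : (fun y => truncSum R a b s c N y - cleanSum R a b s c y) =
        fun y => -∑ n ∈ s, (c n * uPhase a n) * (expTail N (uLin a n y) * qPart R b n y.2) := by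
      funext y
      rw [← cleanSum_sub_truncSum R a b s c N y]
      ring
    rw [hfun, dsup_neg]
    have hterm : ∀ n ∈ s, ContDiff ℝ ∞ fun y : OrthSpace m ι₂ =>
        (c n * uPhase a n) * (expTail N (uLin a n y) * qPart R b n y.2) := fun n _ =>
      contDiff_const.mul (((contDiff_expTail N).comp (uLin a n).contDiff).mul
        ((contDiff_qPart R b n).comp contDiff_snd))
    refine (dsup_sum_le s hterm n₀ v).trans ?_
    rw [Finset.sum_mul]
    refine Finset.sum_le_sum fun n hn => ?_
    have h1 : ContDiff ℝ ∞ fun y : OrthSpace m ι₂ => expTail N (uLin a n y) * qPart R b n y.2 :=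
      ((contDiff_expTail N).comp (uLin a n).contDiff).mul ((contDiff_qPart R b n).comp contDiff_snd)
    refine (dsup_const_mul_le _ h1 n₀ v).trans ?_
    rw [norm_mul, norm_uPhase, mul_one]
    refine mul_le_mul_of_nonneg_left ?_ (norm_nonneg _)
    refine (dsup_mul_le ((contDiff_expTail N).comp (uLin a n).contDiff)
      ((contDiff_qPart R b n).comp contDiff_snd) n₀ v).trans ?_
    have h2 := dsup_expTail_uLin_le (hΛ n hn) hτ0 hτ hv'
    have h3 : dsup n₀ (fun y : OrthSpace m ι₂ => qPart R b n y.2) v ≤ Mq :=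
      (dsup_comp_snd_le (contDiff_qPart R b n) n₀ v).trans (hMq n hn v.2)
    have h4 := dsup_nonneg n₀ (fun y : OrthSpace m ι₂ => qPart R b n y.2) v
    have h5 := dsup_nonneg n₀ (fun y : OrthSpace m ι₂ => expTail N (uLin a n y)) v
    calc (2 : ℝ) ^ n₀ * dsup n₀ (fun y : OrthSpace m ι₂ => expTail N (uLin a n y)) v *
          dsup n₀ (fun y : OrthSpace m ι₂ => qPart R b n y.2) v
        ≤ 2 ^ n₀ * (τ * max 1 Λ ^ n₀) * Mq := by
          gcongr
    _ = _ := rfl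
  linarith [hb'.le, dsup_nonneg n₀ (fun y => cleanSum R a b s c y - engineSum R a b ha hb s c y) v]

/-- The error function `G − φ` is `H' ∘ expNegMap`, `H' = (∏ uᵢ)(truncSum − Ψ)`. [folklore] -/
theorem approxG_sub_eq (hφR : tsupport φ ⊆ Metric.closedBall 0 R) :
    (fun y => approxG R a b s c N y - φ y) = fun y =>
      (fun v : OrthSpace m ι₂ => ((∏ i, v.1 i : ℝ) : ℂ) * (truncSum R a b s c N v - pullback φ R v))
        (expNegMap m (EuclideanSpace ℝ ι₂) y) := by
  funext y
  rw [← prodExp_mul_pullback_expNegMap hφR y, approxG]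
  have h : (∏ i, (expNegMap m (EuclideanSpace ℝ ι₂) y).1 i) = ∏ i, Real.exp (-(y.1 i)) :=
    Finset.prod_congr rfl fun i _ => expNegMap_fst y i
  simp only [h]
  ring

/-- **(E2) The core estimate.** For `x` in the orthant with `‖x‖ ≤ R + 2`,
`(1 + ‖x‖)^k dsup n₀ (G − φ)(x) ≤ (R + 3)^k · n₀! e^{n₀} · 2^{n₀} (n₀+1)^m · [three-term bound]`. [folklore] -/
theorem weighted_dsup_core_le (hR : 0 ≤ R) (hφ : ContDiff ℝ ∞ φ)
    (hφR : tsupport φ ⊆ Metric.closedBall 0 R)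
    (hΛ : ∀ n ∈ s, uSize m ι₂ a n ≤ Λ) (hτ0 : 0 ≤ τ)
    (hτ : ∀ j, j ≤ n₀ → ∀ t : ℝ, |t| ≤ Λ → ‖iteratedDeriv j (expTail N) t‖ ≤ τ)
    (hMq0 : 0 ≤ Mq) (hMq : ∀ n ∈ s, ∀ q, dsup n₀ (qPart R b n) q ≤ Mq)
    (hS : ∀ v, dsup n₀ (fun y => engineSum R a b ha hb s c y - pullback φ R y) v ≤ δ₁) (hδ₁ : 0 ≤ δ₁)
    (k : ℕ) {x : OrthSpace m ι₂} (hx : x ∈ orthant m ι₂) (hxR : ‖x‖ ≤ R + 2) :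
    (1 + ‖x‖) ^ k * dsup n₀ (fun y => approxG R a b s c N y - φ y) x ≤
      (R + 3) ^ k * (n₀.factorial * Real.exp 1 ^ n₀ * (2 ^ n₀ * (n₀ + 1 : ℝ) ^ m)) *
        (δ₁ + (∑ n ∈ s, ‖c n‖) * (2 ^ n₀ * (τ * max 1 Λ ^ n₀) * Mq)) := by
  set v := expNegMap m (EuclideanSpace ℝ ι₂) x with hv
  have hv1 : ∀ i, 0 ≤ v.1 i ∧ v.1 i ≤ 1 := fun i => by
    rw [hv, expNegMap_fst]
    exact ⟨(Real.exp_pos _).le, Real.exp_le_one_iff.2 (by linarith [hx i])⟩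
  have hv' : ∀ i, |v.1 i| ≤ 1 := fun i => abs_le.2 ⟨by linarith [(hv1 i).1], (hv1 i).2⟩
  set Bd := δ₁ + (∑ n ∈ s, ‖c n‖) * (2 ^ n₀ * (τ * max 1 Λ ^ n₀) * Mq) with hBd
  have hBd0 : 0 ≤ Bd := by positivity
  have hE1 := dsup_truncSum_sub_pullback_le (ha := ha) (hb := hb) hR hφ hΛ hτ0 hτ hMq0 hMq hS hv1
  -- the function `H'` and its jet at `v`
  have hTP : ContDiff ℝ ∞ fun w : OrthSpace m ι₂ => truncSum R a b s c N w - pullback φ R w :=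
    (contDiff_truncSum R a b s c N).sub (contDiff_pullback hφ R)
  have hprodC : ContDiff ℝ ∞ fun w : OrthSpace m ι₂ => ((∏ i, w.1 i : ℝ) : ℂ) :=
    Complex.ofRealCLM.contDiff.comp ((contDiff_prodCoord Finset.univ).comp contDiff_fst)
  have hH := hprodC.mul hTP
  have hjet : dsup n₀ (fun w : OrthSpace m ι₂ =>
      ((∏ i, w.1 i : ℝ) : ℂ) * (truncSum R a b s c N w - pullback φ R w)) v ≤
      (2 ^ n₀ * (n₀ + 1 : ℝ) ^ m) * Bd := by
    refine (dsup_mul_le hprodC hTP n₀ v).trans ?_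
    have h1 := dsup_prodCoord_le (ι₂ := ι₂) Finset.univ hv' n₀
    have h2 := dsup_nonneg n₀ (fun w : OrthSpace m ι₂ => truncSum R a b s c N w - pullback φ R w) v
    calc (2 : ℝ) ^ n₀ * dsup n₀ (fun y : OrthSpace m ι₂ => ((∏ j ∈ Finset.univ, y.1 j : ℝ) : ℂ)) v *
          dsup n₀ (fun w => truncSum R a b s c N w - pullback φ R w) v
        ≤ 2 ^ n₀ * (n₀ + 1 : ℝ) ^ m * Bd := by gcongr
    _ = _ := by ring
  -- compose with `expNegMap`
  rw [approxG_sub_eq hφR]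
  have hcomp := dsup_comp_expNegMap_le hH (fun i => by linarith [hx i]) n₀ (x := x)
  have hw : (1 + ‖x‖) ^ k ≤ (R + 3) ^ k :=
    pow_le_pow_left₀ (by positivity) (by linarith) k
  have h0 := dsup_nonneg n₀ (fun y => (fun v : OrthSpace m ι₂ =>
    ((∏ i, v.1 i : ℝ) : ℂ) * (truncSum R a b s c N v - pullback φ R v)) (expNegMap m (EuclideanSpace ℝ ι₂) y)) x
  calc (1 + ‖x‖) ^ k * dsup n₀ (fun y => (fun v : OrthSpace m ι₂ =>
        ((∏ i, v.1 i : ℝ) : ℂ) * (truncSum R a b s c N v - pullback φ R v)) (expNegMap m (EuclideanSpace ℝ ι₂) y)) x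
      ≤ (R + 3) ^ k * (n₀.factorial * Real.exp 1 ^ n₀ * ((2 ^ n₀ * (n₀ + 1 : ℝ) ^ m) * Bd)) := by
        refine mul_le_mul hw (hcomp.trans ?_) h0 (by positivity)
        exact mul_le_mul_of_nonneg_left hjet (by positivity)
    _ = _ := by ring

/-- **(E3) Far in the Fourier variables both `G` and `φ` vanish.** [folklore] -/
theorem dsup_approxG_sub_eq_zero_of_snd (hR : 0 ≤ R) (hφR : tsupport φ ⊆ Metric.closedBall 0 R)
    {x : OrthSpace m ι₂} (hx : R + 2 < ‖x.2‖) :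
    dsup n₀ (fun y => approxG R a b s c N y - φ y) x = 0 := by
  refine dsup_eq_zero_of_notMem_tsupport ?_
  rw [notMem_tsupport_iff_eventuallyEq]
  have hO : IsOpen {y : OrthSpace m ι₂ | R + 2 < ‖y.2‖} := isOpen_lt continuous_const continuous_snd.norm
  filter_upwards [hO.mem_nhds hx] with y hy
  have hφy : φ y = 0 := by
    refine image_eq_zero_of_notMem_tsupport fun h => ?_
    have h1 := hφR h
    rw [Metric.mem_closedBall, dist_zero_right] at h1
    have h2 : ‖y.2‖ ≤ ‖y‖ := norm_snd_le y
    have h3 : R + 2 < ‖y.2‖ := hy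
    linarith
  have hG : approxG R a b s c N y = 0 := by
    rw [approxG, truncSum]
    have : ∀ n ∈ s, c n * (uPhase a n * expTrunc N (uLin a n (expNegMap m (EuclideanSpace ℝ ι₂) y))) *
        qPart R b n (expNegMap m (EuclideanSpace ℝ ι₂) y).2 = 0 := fun n _ => by
      rw [expNegMap_snd, qPart_eq_zero (by rw [abs_of_nonneg hR]; exact (le_of_lt hy : R + 2 ≤ ‖y.2‖)),
        mul_zero]
    rw [Finset.sum_eq_zero this, mul_zero]
  rw [Pi.zero_apply, hφy, hG, sub_zero]

/-- `(1 + s)^k e^{-s} ≤ k! · e` for `s ≥ 0` (from `x^k / k! ≤ e^x`). [folklore] -/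
theorem one_add_pow_mul_exp_neg_le_factorial_mul_e {s : ℝ} (hs : 0 ≤ s) (k : ℕ) :
    (1 + s) ^ k * Real.exp (-s) ≤ k.factorial * Real.exp 1 := by
  have h1 : (1 + s) ^ k / k.factorial ≤ Real.exp (1 + s) := Real.pow_div_factorial_le_exp (1 + s) (by linarith) k
  have hk : (0 : ℝ) < k.factorial := by exact_mod_cast Nat.factorial_pos k
  rw [div_le_iff₀ hk] at h1
  have h2 : Real.exp (1 + s) = Real.exp 1 * Real.exp s := Real.exp_add 1 s
  have h3 : Real.exp s * Real.exp (-s) = 1 := by rw [← Real.exp_add, add_neg_cancel, Real.exp_zero]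
  calc (1 + s) ^ k * Real.exp (-s) ≤ Real.exp (1 + s) * k.factorial * Real.exp (-s) := by
        gcongr
    _ = k.factorial * Real.exp 1 * (Real.exp s * Real.exp (-s)) := by rw [h2]; ring
    _ = k.factorial * Real.exp 1 := by rw [h3, mul_one]

/-- **(E4) Near a face both `φ` and `Ψ` vanish and the factor `u_{i₀} = e^{-σ_{i₀}}` of `G` absorbs
the weight.** For `x` in the orthant with `‖x₂‖ ≤ R + 2` and a maximal coordinate
`σ_{i₀} > R + 2`, `(1 + ‖x‖)^k dsup n₀ (G − φ)(x) ≤ k! e 2^{n₀} · n₀! e^{n₀} · 2^{n₀} (n₀+1)^m ·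
[three-term bound]`. [folklore] -/
theorem weighted_dsup_face_le (hR : 0 ≤ R) (hφ : ContDiff ℝ ∞ φ)
    (hφR : tsupport φ ⊆ Metric.closedBall 0 R)
    (hΛ : ∀ n ∈ s, uSize m ι₂ a n ≤ Λ) (hτ0 : 0 ≤ τ)
    (hτ : ∀ j, j ≤ n₀ → ∀ t : ℝ, |t| ≤ Λ → ‖iteratedDeriv j (expTail N) t‖ ≤ τ)
    (hMq0 : 0 ≤ Mq) (hMq : ∀ n ∈ s, ∀ q, dsup n₀ (qPart R b n) q ≤ Mq)
    (hS : ∀ v, dsup n₀ (fun y => engineSum R a b ha hb s c y - pullback φ R y) v ≤ δ₁) (hδ₁ : 0 ≤ δ₁)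
    (k : ℕ) {x : OrthSpace m ι₂} (hx : x ∈ orthant m ι₂) (hx2 : ‖x.2‖ ≤ R + 2) {i₀ : Fin m}
    (hi₀ : R + 2 < x.1 i₀) (hmax : ∀ i, x.1 i ≤ x.1 i₀) :
    (1 + ‖x‖) ^ k * dsup n₀ (fun y => approxG R a b s c N y - φ y) x ≤
      (k.factorial * Real.exp 1 * 2 ^ n₀) * (n₀.factorial * Real.exp 1 ^ n₀ * (2 ^ n₀ * (n₀ + 1 : ℝ) ^ m)) *
        (δ₁ + (∑ n ∈ s, ‖c n‖) * (2 ^ n₀ * (τ * max 1 Λ ^ n₀) * Mq)) := by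
  set v := expNegMap m (EuclideanSpace ℝ ι₂) x with hv
  have hv1 : ∀ i, 0 ≤ v.1 i ∧ v.1 i ≤ 1 := fun i => by
    rw [hv, expNegMap_fst]
    exact ⟨(Real.exp_pos _).le, Real.exp_le_one_iff.2 (by linarith [hx i])⟩
  have hv' : ∀ i, |v.1 i| ≤ 1 := fun i => abs_le.2 ⟨by linarith [(hv1 i).1], (hv1 i).2⟩
  set Bd := δ₁ + (∑ n ∈ s, ‖c n‖) * (2 ^ n₀ * (τ * max 1 Λ ^ n₀) * Mq) with hBd
  have hBd0 : 0 ≤ Bd := by positivity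
  have hE1 := dsup_truncSum_sub_pullback_le (ha := ha) (hb := hb) hR hφ hΛ hτ0 hτ hMq0 hMq hS hv1
  -- `‖x‖ = σ_{i₀}`
  have hx1 : ‖x.1‖ = x.1 i₀ := by
    refine le_antisymm ((pi_norm_le_iff_of_nonneg (by linarith)).2 fun i => ?_) ?_
    · rw [Real.norm_eq_abs, abs_of_nonneg (hx i)]; exact hmax i
    · exact (le_abs_self _).trans ((Real.norm_eq_abs _).symm.le.trans (norm_le_pi_norm x.1 i₀))
  have hxn : ‖x‖ = x.1 i₀ := by
    rw [Prod.norm_def, hx1]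
    exact max_eq_left (by linarith)
  -- `φ` does not contribute
  have hφx : dsup n₀ φ x = 0 := by
    refine dsup_eq_zero_of_notMem_tsupport fun h => ?_
    have h1 := hφR h
    rw [Metric.mem_closedBall, dist_zero_right, hxn] at h1
    linarith
  have hG := contDiff_approxG (ι₂ := ι₂) R a b s c N
  have hdiff : dsup n₀ (fun y => approxG R a b s c N y - φ y) x ≤ dsup n₀ (approxG R a b s c N) x := by
    have := dsup_sub_le hG hφ n₀ x
    rw [hφx, add_zero] at this
    exact this
  -- factor `G = e^{-σ_{i₀}} · E' ∘ expNegMap`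
  set E' : OrthSpace m ι₂ → ℂ :=
    fun w => ((∏ i ∈ Finset.univ.erase i₀, w.1 i : ℝ) : ℂ) * truncSum R a b s c N w
  have hfac : approxG R a b s c N =
      fun y => ((Real.exp (-(y.1 i₀)) : ℝ) : ℂ) * E' (expNegMap m (EuclideanSpace ℝ ι₂) y) := by
    funext y
    simp only [E', approxG]
    rw [← Finset.mul_prod_erase Finset.univ _ (Finset.mem_univ i₀), expNegMap_fst]
    push_cast
    ring
  have hT := contDiff_truncSum (ι₂ := ι₂) R a b s c N
  have hprodC : ContDiff ℝ ∞ fun w : OrthSpace m ι₂ => ((∏ i ∈ Finset.univ.erase i₀, w.1 i : ℝ) : ℂ) :=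
    Complex.ofRealCLM.contDiff.comp ((contDiff_prodCoord (Finset.univ.erase i₀)).comp contDiff_fst)
  have hE'c : ContDiff ℝ ∞ E' := hprodC.mul hT
  have hexpC : ContDiff ℝ ∞ fun y : OrthSpace m ι₂ => ((Real.exp (-(y.1 i₀)) : ℝ) : ℂ) :=
    Complex.ofRealCLM.contDiff.comp (Real.contDiff_exp.comp ((contDiff_apply ℝ ℝ i₀).comp contDiff_fst).neg)
  have hE'f : ContDiff ℝ ∞ fun y : OrthSpace m ι₂ => E' (expNegMap m (EuclideanSpace ℝ ι₂) y) :=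
    hE'c.comp contDiff_expNegMap
  -- `Ψ` vanishes at `v`, so the jet of `truncSum` at `v` is at most the three-term bound
  have hΨv : dsup n₀ (pullback φ R) v = 0 :=
    dsup_eq_zero_of_notMem_tsupport (expNegMap_notMem_tsupport_pullback hφR (le_of_lt hi₀))
  have hTv : dsup n₀ (truncSum R a b s c N) v ≤ Bd := by
    have hsplit : truncSum R a b s c N = fun w => (truncSum R a b s c N w - pullback φ R w) + pullback φ R w := by
      funext w; ring
    have h := dsup_add_le (hT.sub (contDiff_pullback hφ R)) (contDiff_pullback hφ R) n₀ v
    rw [← hsplit, hΨv, add_zero] at h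
    exact h.trans hE1
  have hE'v : dsup n₀ E' v ≤ (2 ^ n₀ * (n₀ + 1 : ℝ) ^ m) * Bd := by
    refine (dsup_mul_le hprodC hT n₀ v).trans ?_
    have h1 := dsup_prodCoord_le (ι₂ := ι₂) (Finset.univ.erase i₀) hv' n₀
    have h2 := dsup_nonneg n₀ (truncSum R a b s c N) v
    calc (2 : ℝ) ^ n₀ * dsup n₀ (fun y : OrthSpace m ι₂ => ((∏ j ∈ Finset.univ.erase i₀, y.1 j : ℝ) : ℂ)) v *
          dsup n₀ (truncSum R a b s c N) v ≤ 2 ^ n₀ * (n₀ + 1 : ℝ) ^ m * Bd := by gcongr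
      _ = _ := by ring
  have hcomp := dsup_comp_expNegMap_le hE'c (fun i => by linarith [hx i]) n₀ (x := x)
  have hGx : dsup n₀ (approxG R a b s c N) x ≤
      2 ^ n₀ * Real.exp (-(x.1 i₀)) * (n₀.factorial * Real.exp 1 ^ n₀ * ((2 ^ n₀ * (n₀ + 1 : ℝ) ^ m) * Bd)) := by
    rw [hfac]
    refine (dsup_mul_le hexpC hE'f n₀ x).trans ?_
    have h1 := dsup_expNeg_le (ι₂ := ι₂) i₀ n₀ x
    have h2 := dsup_nonneg n₀ (fun y : OrthSpace m ι₂ => E' (expNegMap m (EuclideanSpace ℝ ι₂) y)) x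
    have h3 : dsup n₀ (fun y : OrthSpace m ι₂ => E' (expNegMap m (EuclideanSpace ℝ ι₂) y)) x ≤
        n₀.factorial * Real.exp 1 ^ n₀ * ((2 ^ n₀ * (n₀ + 1 : ℝ) ^ m) * Bd) :=
      hcomp.trans (mul_le_mul_of_nonneg_left hE'v (by positivity))
    exact mul_le_mul (mul_le_mul_of_nonneg_left h1 (by positivity)) h3 h2 (by positivity)
  -- the weight
  have hx0 : 0 ≤ x.1 i₀ := by linarith
  have hw := one_add_pow_mul_exp_neg_le_factorial_mul_e hx0 k
  have h0 := dsup_nonneg n₀ (fun y => approxG R a b s c N y - φ y) x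
  calc (1 + ‖x‖) ^ k * dsup n₀ (fun y => approxG R a b s c N y - φ y) x
      ≤ (1 + x.1 i₀) ^ k * (2 ^ n₀ * Real.exp (-(x.1 i₀)) *
          (n₀.factorial * Real.exp 1 ^ n₀ * ((2 ^ n₀ * (n₀ + 1 : ℝ) ^ m) * Bd))) := by
        rw [hxn]
        exact mul_le_mul_of_nonneg_left (hdiff.trans hGx) (by positivity)
    _ = ((1 + x.1 i₀) ^ k * Real.exp (-(x.1 i₀))) * 2 ^ n₀ *
          (n₀.factorial * Real.exp 1 ^ n₀ * (2 ^ n₀ * (n₀ + 1 : ℝ) ^ m)) * Bd := by ring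
    _ ≤ (k.factorial * Real.exp 1) * 2 ^ n₀ *
          (n₀.factorial * Real.exp 1 ^ n₀ * (2 ^ n₀ * (n₀ + 1 : ℝ) ^ m)) * Bd :=
        mul_le_mul_of_nonneg_right (mul_le_mul_of_nonneg_right
          (mul_le_mul_of_nonneg_right hw (by positivity)) (by positivity)) hBd0
    _ = _ := by ring

end Estimates

/-! ### The density theorem -/

section Main

/-- A maximal coordinate of `σ ∈ ℝ^m` realises the sup norm when all coordinates are nonnegative
and one of them is positive. [folklore] -/
theorem exists_max_coord {σ : Fin m → ℝ} (hσ : ∀ i, 0 ≤ σ i) (hpos : 0 < ‖σ‖) :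
    ∃ i₀, (∀ i, σ i ≤ σ i₀) ∧ ‖σ‖ = σ i₀ := by
  have hne : (Finset.univ : Finset (Fin m)).Nonempty := by
    by_contra h
    rw [Finset.not_nonempty_iff_eq_empty, Finset.univ_eq_empty_iff] at h
    have : σ = 0 := Subsingleton.elim _ _
    rw [this, norm_zero] at hpos
    exact lt_irrefl _ hpos
  obtain ⟨i₀, -, hi₀⟩ := Finset.exists_max_image Finset.univ σ hne
  refine ⟨i₀, fun i => hi₀ i (Finset.mem_univ i), le_antisymm ?_ ?_⟩
  · refine (pi_norm_le_iff_of_nonneg (hσ i₀)).2 fun i => ?_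
    rw [Real.norm_eq_abs, abs_of_nonneg (hσ i)]
    exact hi₀ i (Finset.mem_univ i)
  · exact (le_abs_self _).trans ((Real.norm_eq_abs _).symm.le.trans (norm_le_pi_norm σ i₀))

/-- **Exponential sums are dense in the Schwartz functions on the closed orthant** (the several
variable form of Osterwalder–Schrader I (1973), Lemma 8.2, at the level of the exponential sums
`∑ c_r e^{-⟨a_r, σ⟩} ψ_r(q)` = Laplace–Fourier transforms of `∑ c_r δ_{a_r} ⊗ ψ̌_r`). For every
compactly supported Schwartz function `φ` on `ℝ^m × ℝ^{ι₂}`, every weight `k`, order `n₀` and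
`ε > 0` there is `G ∈ expSumSpan` (rates in `[1, ∞)^m`, smooth compactly supported `q`-factors) with
`(1 + ‖x‖)^k · max_{i ≤ n₀} ‖Dⁱ(G − φ)(x)‖ ≤ ε` for all `x` in the closed orthant `{σᵢ ≥ 0}`.
[cite: OsterwalderSchraderCMP1973, §8 Lemma 8.2] -/
theorem exists_expSum_approx (φ : 𝓢(OrthSpace m ι₂, ℂ)) (hφc : HasCompactSupport (φ : OrthSpace m ι₂ → ℂ))
    (k n₀ : ℕ) {ε : ℝ} (hε : 0 < ε) :
    ∃ G ∈ expSumSpan m ι₂, ∀ x ∈ orthant m ι₂,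
      (1 + ‖x‖) ^ k * dsup n₀ (fun y => G y - φ y) x ≤ ε := by
  -- support radius `R ≥ 0`
  obtain ⟨R₀, hR₀⟩ := (hφc : IsCompact (tsupport (φ : OrthSpace m ι₂ → ℂ))).isBounded.subset_closedBall 0
  set R : ℝ := max R₀ 0 with hRdef
  have hR : 0 ≤ R := le_max_right _ _
  have hφR : tsupport (φ : OrthSpace m ι₂ → ℂ) ⊆ Metric.closedBall 0 R :=
    hR₀.trans (Metric.closedBall_subset_closedBall (le_max_left _ _))
  have hφ : ContDiff ℝ ∞ (φ : OrthSpace m ι₂ → ℂ) := φ.smooth ⊤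
  -- box data and the engine
  set a : ℝ := boxA R with hadef
  set b : ℝ := boxB R with hbdef
  have ha : a ≠ 0 := (boxA_pos R).ne'
  have hb : b ≠ 0 := (boxB_pos hR).ne'
  set L := scaleCLE (m := m) (ι₂ := ι₂) a b ha hb with hL
  set w := boxShiftVec m ι₂ a with hw
  set ΨS : 𝓢(OrthSpace m ι₂, ℂ) := (hasCompactSupport_pullback hφR).toSchwartzMap (contDiff_pullback hφ R)
    with hΨS
  have hengine := tendsto_sum_charQS (m := m) (ι₂ := ι₂) hR hφ hφR
  set c : (Fin m ⊕ ι₂ → ℤ) → ℂ := fun n => boxCoeff L w ΨS n with hcdef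
  -- the master constant
  set K₂ : ℝ := n₀.factorial * Real.exp 1 ^ n₀ * (2 ^ n₀ * (n₀ + 1 : ℝ) ^ m) with hK₂
  set K₁ : ℝ := max ((R + 3) ^ k) (k.factorial * Real.exp 1 * 2 ^ n₀) with hK₁
  have hK₂0 : 0 < K₂ := by positivity
  have hK₁0 : 0 < K₁ := lt_max_of_lt_left (by positivity)
  set K : ℝ := K₁ * K₂ with hK
  have hK0 : 0 < K := mul_pos hK₁0 hK₂0
  -- step 1: the engine error `δ₁`
  set δ₁ : ℝ := ε / (2 * K) with hδ₁
  have hδ₁0 : 0 < δ₁ := by positivity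
  have hev : ∀ᶠ s : Finset (Fin m ⊕ ι₂ → ℤ) in atTop, ∀ j ∈ Finset.range (n₀ + 1),
      schwartzSeminormFamily ℂ (OrthSpace m ι₂) ℂ (0, j)
        (∑ n ∈ s, c n • charQS R a b ha hb n - ΨS) < δ₁ := by
    rw [Finset.eventually_all]
    intro j _
    exact ((schwartz_withSeminorms ℂ (OrthSpace m ι₂) ℂ).tendsto_nhds _ _).1 hengine (0, j) δ₁ hδ₁0
  obtain ⟨s, hs⟩ := hev.exists
  have hS : ∀ v, dsup n₀ (fun y => engineSum R a b ha hb s c y - pullback φ R y) v ≤ δ₁ := by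
    intro v
    have hcoe : (fun y => engineSum R a b ha hb s c y - pullback φ R y) =
        ⇑(∑ n ∈ s, c n • charQS R a b ha hb n - ΨS) := by
      funext y
      simp only [engineSum, hΨS, sub_apply, sum_apply, smul_apply, smul_eq_mul]
      rfl
    rw [hcoe]
    refine dsup_le_iff.2 fun j hj => ?_
    have h1 := SchwartzMap.norm_iteratedFDeriv_le_seminorm ℂ (∑ n ∈ s, c n • charQS R a b ha hb n - ΨS) j v
    have h2 := hs j (Finset.mem_range.2 (Nat.lt_succ_of_le hj))
    rw [SchwartzMap.schwartzSeminormFamily_apply] at h2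
    exact h1.trans h2.le
  -- step 2: the data of `s`
  set Λ : ℝ := ∑ n ∈ s, uSize m ι₂ a n with hΛdef
  have hΛ : ∀ n ∈ s, uSize m ι₂ a n ≤ Λ := fun n hn =>
    Finset.single_le_sum (f := fun n => uSize m ι₂ a n) (fun n _ => uSize_nonneg a n) hn
  have hΛ0 : 0 ≤ Λ := Finset.sum_nonneg fun n _ => uSize_nonneg a n
  have hMex : ∀ n : Fin m ⊕ ι₂ → ℤ, ∃ M : ℝ, 0 ≤ M ∧ ∀ q, dsup n₀ (qPart (ι₂ := ι₂) R b n) q ≤ M := fun n =>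
    exists_dsup_le_of_hasCompactSupport (contDiff_qPart R b n) (hasCompactSupport_qPart R b n) n₀
  choose M hM0 hM using hMex
  set Mq : ℝ := ∑ n ∈ s, M n with hMqdef
  have hMq0 : 0 ≤ Mq := Finset.sum_nonneg fun n _ => hM0 n
  have hMq : ∀ n ∈ s, ∀ q, dsup n₀ (qPart (ι₂ := ι₂) R b n) q ≤ Mq := fun n hn q =>
    (hM n q).trans (Finset.single_le_sum (f := M) (fun n _ => hM0 n) hn)
  set B : ℝ := ∑ n ∈ s, ‖c n‖ with hBdef
  have hB0 : 0 ≤ B := Finset.sum_nonneg fun n _ => norm_nonneg _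
  -- step 3: the truncation order
  set τ : ℝ := ε / (2 * K * (B * (2 ^ n₀ * max 1 Λ ^ n₀ * Mq) + 1)) with hτdef
  have hden : 0 < B * (2 ^ n₀ * max 1 Λ ^ n₀ * Mq) + 1 := by positivity
  have hτ0 : 0 < τ := by positivity
  obtain ⟨N₀, hN₀⟩ := exists_forall_norm_iteratedDeriv_expTail_le Λ n₀ hτ0
  have hτ : ∀ j, j ≤ n₀ → ∀ t : ℝ, |t| ≤ Λ → ‖iteratedDeriv j (expTail N₀) t‖ ≤ τ :=
    fun j hj t ht => hN₀ N₀ le_rfl j hj t ht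
  -- the approximant
  refine ⟨approxG R a b s c N₀, approxG_mem R a b s c N₀, fun x hx => ?_⟩
  -- the three-term bound is `≤ ε / K`
  set Bd : ℝ := δ₁ + (∑ n ∈ s, ‖c n‖) * (2 ^ n₀ * (τ * max 1 Λ ^ n₀) * Mq) with hBd
  have hBdK : K * Bd ≤ ε := by
    have h1 : K * δ₁ = ε / 2 := by
      rw [hδ₁]; field_simp
    have h2 : K * ((∑ n ∈ s, ‖c n‖) * (2 ^ n₀ * (τ * max 1 Λ ^ n₀) * Mq)) ≤ ε / 2 := by
      have heq : K * ((∑ n ∈ s, ‖c n‖) * (2 ^ n₀ * (τ * max 1 Λ ^ n₀) * Mq)) =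
          (ε / 2) * ((B * (2 ^ n₀ * max 1 Λ ^ n₀ * Mq)) / (B * (2 ^ n₀ * max 1 Λ ^ n₀ * Mq) + 1)) := by
        rw [hτdef, ← hBdef]
        field_simp
      rw [heq]
      have h3 : (B * (2 ^ n₀ * max 1 Λ ^ n₀ * Mq)) / (B * (2 ^ n₀ * max 1 Λ ^ n₀ * Mq) + 1) ≤ 1 := by
        rw [div_le_one hden]; linarith
      calc ε / 2 * (B * (2 ^ n₀ * max 1 Λ ^ n₀ * Mq) / (B * (2 ^ n₀ * max 1 Λ ^ n₀ * Mq) + 1))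
          ≤ ε / 2 * 1 := mul_le_mul_of_nonneg_left h3 (by positivity)
        _ = ε / 2 := mul_one _
    calc K * Bd = K * δ₁ + K * ((∑ n ∈ s, ‖c n‖) * (2 ^ n₀ * (τ * max 1 Λ ^ n₀) * Mq)) := by
          rw [hBd]; ring
      _ ≤ ε / 2 + ε / 2 := by rw [h1]; exact add_le_add le_rfl h2
      _ = ε := by ring
  have hBd0 : 0 ≤ Bd := by positivity
  -- case analysis on the position of `x`
  by_cases hq : R + 2 < ‖x.2‖
  · rw [dsup_approxG_sub_eq_zero_of_snd (a := a) (b := b) (s := s) (c := c) (N := N₀) (n₀ := n₀) hR hφR hq,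
      mul_zero]
    exact hε.le
  push Not at hq
  by_cases hcore : ‖x‖ ≤ R + 2
  · have h := weighted_dsup_core_le (ha := ha) (hb := hb) hR hφ hφR hΛ hτ0.le hτ hMq0 hMq hS hδ₁0.le k hx hcore
    refine h.trans ?_
    calc (R + 3) ^ k * K₂ * Bd ≤ K₁ * K₂ * Bd := by
          gcongr
          exact le_max_left _ _
      _ = K * Bd := by rw [hK]
      _ ≤ ε := hBdK
  · push Not at hcore
    have hx1 : R + 2 < ‖x.1‖ := by
      rw [Prod.norm_def] at hcore
      rcases le_or_gt ‖x.1‖ ‖x.2‖ with h | h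
      · rw [max_eq_right h] at hcore; linarith
      · rw [max_eq_left h.le] at hcore; exact hcore
    have hpos : 0 < ‖x.1‖ := by linarith
    obtain ⟨i₀, hmax, hnorm⟩ := exists_max_coord hx hpos
    have hi₀ : R + 2 < x.1 i₀ := by rwa [hnorm] at hx1
    have h := weighted_dsup_face_le (ha := ha) (hb := hb) hR hφ hφR hΛ hτ0.le hτ hMq0 hMq hS hδ₁0.le k hx hq hi₀ hmax
    refine h.trans ?_
    calc (k.factorial * Real.exp 1 * 2 ^ n₀) * K₂ * Bd ≤ K₁ * K₂ * Bd := by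
          gcongr
          exact le_max_right _ _
      _ = K * Bd := by rw [hK]
      _ ≤ ε := hBdK

/-- The same statement with iterated derivatives instead of `dsup`. [cite: OsterwalderSchraderCMP1973, §8 Lemma 8.2] -/
theorem exists_expSum_approx' (φ : 𝓢(OrthSpace m ι₂, ℂ)) (hφc : HasCompactSupport (φ : OrthSpace m ι₂ → ℂ))
    (k n₀ : ℕ) {ε : ℝ} (hε : 0 < ε) :
    ∃ G ∈ expSumSpan m ι₂, ∀ x ∈ orthant m ι₂, ∀ i, i ≤ n₀ →
      (1 + ‖x‖) ^ k * ‖iteratedFDeriv ℝ i (fun y => G y - φ y) x‖ ≤ ε := by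
  obtain ⟨G, hG, h⟩ := exists_expSum_approx φ hφc k n₀ hε
  refine ⟨G, hG, fun x hx i hi => (mul_le_mul_of_nonneg_left
    (norm_iteratedFDeriv_le_dsup hi (fun y => G y - φ y) x) (by positivity)).trans (h x hx)⟩

end Main

end Literature.Analysis.Distribution
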